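import Literature.Topology.FourManifolds.WhiteheadBend
import HarnessLib

/-!
# Whitehead triangulations, the bending step (Munkres 10.2–10.3), parts E–H: the bent map

Continuation of `Literature.Topology.FourManifolds.WhiteheadBend`.  Given the set-up `S` of the
bending step we construct and study the bent map:

* Part E — estimates on active simplices (Taylor, two-point, derivative; the bent model `Bt` is an
  immersion on each active top simplex), the bent chart-image map `B = F + (θ ∘ F) • (Λ - F)` and
  the bent map `f'` (`fbend`), the chart-level map `g = id + θ • w` (`ε'`-Lipschitz deviation from
  the identity on active pieces and on good balls, hence injective there by the inverse function
  estimates of `ApproximatesLinearOn`), the trimmed pure subcomplex `K''` (`Kb`) of the refinement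
  and the injectivity of `f'` on it (`injOn_fbend`, Munkres 10.2);
* Part F — continuity of `f'` on simplices, the smooth chart models of `f'` on active top
  simplices with injective derivative (`model_active`), straightness near `R₂` (`straight`);
* Part H — coverage: every protected point has a neighbourhood inside `f' '' K''.space`
  (`exists_open_subset_image`).

No named facts are introduced.
-/

open Set Function Metric Filter
open scoped Topology NNReal ContDiff Manifold

noncomputable section

-- `[T2Space M]` is a section variable used by most lemmas below; per-lemma `omit` would be noise.
set_option linter.unusedSectionVars false

namespace Literature.Topology.FourManifolds

open Literature.Analysis.Convexity Literature.Analysis.Calculus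

local notation "𝔼 " n:arg => EuclideanSpace ℝ (Fin n)

namespace BendInput

variable {n N : ℕ} {M : Type*} [TopologicalSpace M] [T2Space M] {I : BendInput n N M}

namespace BendSetup

variable (S : BendSetup I)

/-! ### Part E: the bent map -/

/-- An active simplex lies in `D`, inside the chart source, and inside the domain of the model of
its top simplex. [folklore] -/
theorem active_subset {s t : Finset (Fin N → ℝ)} (hs : s ∈ I.Top)
    (hts : convexHull ℝ (t : Set (Fin N → ℝ)) ⊆ convexHull ℝ (s : Set (Fin N → ℝ)))
    (htZ : convexHull ℝ (t : Set (Fin N → ℝ)) ⊆ I.Zact) :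
    convexHull ℝ (t : Set (Fin N → ℝ)) ⊆ convexHull ℝ (s : Set (Fin N → ℝ)) ∩ I.f ⁻¹' I.e.source ∧
      convexHull ℝ (t : Set (Fin N → ℝ)) ⊆ S.O s :=
  have h1 : convexHull ℝ (t : Set (Fin N → ℝ)) ⊆ convexHull ℝ (s : Set (Fin N → ℝ)) ∩ I.f ⁻¹' I.e.source :=
    fun _ hx => ⟨hts hx, (I.Zact_subset_D (htZ hx)).2⟩
  ⟨h1, h1.trans (S.hmodel s hs).2.1⟩

/-- **Taylor estimate on an active simplex**: `‖G v - G x - G'(x)(v - x)‖ ≤ (B₂ / m) ‖v - x‖`.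
[folklore] -/
theorem taylor_le {s t : Finset (Fin N → ℝ)} (hs : s ∈ I.Top) (ht : t ∈ S.P.faces)
    (hts : convexHull ℝ (t : Set (Fin N → ℝ)) ⊆ convexHull ℝ (s : Set (Fin N → ℝ)))
    (htZ : convexHull ℝ (t : Set (Fin N → ℝ)) ⊆ I.Zact) {x v : Fin N → ℝ}
    (hx : x ∈ convexHull ℝ (t : Set (Fin N → ℝ))) (hv : v ∈ convexHull ℝ (t : Set (Fin N → ℝ))) :
    ‖S.G s v - S.G s x - fderiv ℝ (S.G s) x (v - x)‖ ≤ (S.B₂ / S.m) * ‖v - x‖ := by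
  obtain ⟨hQ, hO⟩ := S.active_subset hs hts htZ
  have hQ' : convexHull ℝ (t : Set (Fin N → ℝ)) ⊆ convexHull ℝ (s : Set (Fin N → ℝ)) ∩ I.Zact :=
    subset_inter hts htZ
  have hLip := ((S.hmodel s hs).2.2.2.2.2.2.1 _ (convex_convexHull ℝ _) hQ').2
  have hdiff : ∀ z ∈ convexHull ℝ (t : Set (Fin N → ℝ)),
      HasFDerivWithinAt (S.G s) (fderiv ℝ (S.G s) z) (convexHull ℝ (t : Set (Fin N → ℝ))) z := fun z hz =>
    (((S.hmodel s hs).2.2.1.contDiffAt ((S.hmodel s hs).1.mem_nhds (hO hz))).differentiableAt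
      (by simp)).hasFDerivAt.hasFDerivWithinAt
  have h := norm_sub_sub_fderiv_le_of_lipschitzOnWith (convex_convexHull ℝ _) hdiff hLip hx hv
  refine h.trans (mul_le_mul_of_nonneg_right ?_ (norm_nonneg _))
  have hd : ‖v - x‖ ≤ 1 / S.m := by rw [← dist_eq_norm]; exact S.dist_le_of_mem_P ht hv hx
  calc (S.B₂ : ℝ) * ‖v - x‖ ≤ S.B₂ * (1 / S.m) := mul_le_mul_of_nonneg_left hd S.B₂.2
    _ = S.B₂ / S.m := by ring

/-- The two-point constant `κ₂ = (n + 1) (B₂ / m) / c` of the secant approximation (Munkres 9.3).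
[folklore] -/
def κ₂ : ℝ := ((n : ℝ) + 1) * (S.B₂ / S.m) / S.c

/-- The derivative constant `κ = (n + 1) κ₂ / c`. [folklore] -/
def κ : ℝ := ((n : ℝ) + 1) * S.κ₂ / S.c

/-- Auxiliary step of the bending construction (`κ₂_nonneg`). [folklore] -/
theorem κ₂_nonneg : 0 ≤ S.κ₂ := by
  have := S.hc
  unfold κ₂; positivity

/-- Auxiliary step of the bending construction (`κ_nonneg`). [folklore] -/
theorem κ_nonneg : 0 ≤ S.κ := by
  have := S.hc
  have := S.κ₂_nonneg
  unfold κ; positivity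

/-- **Two-point estimate** (Munkres 9.3): `‖(A y - A x) - G'(x)(y - x)‖ ≤ κ₂ ‖y - x‖` on an active
top simplex of the refinement. [folklore] -/
theorem two_point_le {s t : Finset (Fin N → ℝ)} (hs : s ∈ I.Top) (ht : t ∈ S.PTop)
    (hts : convexHull ℝ (t : Set (Fin N → ℝ)) ⊆ convexHull ℝ (s : Set (Fin N → ℝ)))
    (htZ : convexHull ℝ (t : Set (Fin N → ℝ)) ⊆ I.Zact) {x y : Fin N → ℝ}
    (hx : x ∈ convexHull ℝ (t : Set (Fin N → ℝ))) (hy : y ∈ convexHull ℝ (t : Set (Fin N → ℝ))) :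
    ‖(S.A t ht.1 y - S.A t ht.1 x) - fderiv ℝ (S.G s) x (y - x)‖ ≤ S.κ₂ * ‖y - x‖ := by
  classical
  have hAv : ∀ v ∈ t, S.A t ht.1 v = S.G s v := fun v hv => by
    rw [S.A_apply_of_mem ht.1 hv]
    exact S.F_eq_G hs (hts (subset_convexHull ℝ _ hv)) (I.Zact_subset_D (htZ (subset_convexHull ℝ _ hv)))
  have h := norm_secant_sub_sub_le hAv S.hc (S.nondegenerate_of_mem_P ht.1) hx hy (fderiv ℝ (S.G s) x)
    (η := S.B₂ / S.m) (by positivity) fun v hv => S.taylor_le hs ht.1 hts htZ hx (subset_convexHull ℝ _ hv)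
  have hcard : (t.card : ℝ) = (n : ℝ) + 1 := by rw [ht.2]; push_cast; ring
  rw [hcard] at h
  exact h

/-- **Derivative estimate** (Munkres 9.3): `‖(A.linear - G'(x)) u‖ ≤ κ ‖u‖` on the direction space
of an active top simplex. [folklore] -/
theorem norm_linear_sub_le {s t : Finset (Fin N → ℝ)} (hs : s ∈ I.Top) (ht : t ∈ S.PTop)
    (hts : convexHull ℝ (t : Set (Fin N → ℝ)) ⊆ convexHull ℝ (s : Set (Fin N → ℝ)))
    (htZ : convexHull ℝ (t : Set (Fin N → ℝ)) ⊆ I.Zact) {x : Fin N → ℝ}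
    (hx : x ∈ convexHull ℝ (t : Set (Fin N → ℝ))) {u : Fin N → ℝ}
    (hu : u ∈ vectorSpan ℝ (t : Set (Fin N → ℝ))) :
    ‖LinearMap.toContinuousLinearMap (S.A t ht.1).linear u - fderiv ℝ (S.G s) x u‖ ≤ S.κ * ‖u‖ := by
  classical
  have h := norm_linear_sub_apply_le (A := S.A t ht.1) (fderiv ℝ (S.G s) x) S.hc
    (S.nondegenerate_of_mem_P ht.1) hx S.κ₂_nonneg
    (fun v hv => S.two_point_le hs ht hts htZ hx (subset_convexHull ℝ _ hv)) hu
  have hcard : (t.card : ℝ) = (n : ℝ) + 1 := by rw [ht.2]; push_cast; ring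
  rw [hcard] at h
  exact h

/-- The model of the bent map on an active top simplex inside the top simplex `s` of `K`:
`Bt = G s + (θ ∘ G s) • (A - G s)`. [folklore] -/
def Bt (s t : Finset (Fin N → ℝ)) (ht : t ∈ S.P.faces) : (Fin N → ℝ) → 𝔼 n :=
  fun y => S.G s y + I.θ (S.G s y) • (S.A t ht y - S.G s y)

/-- The deviation bound `κ + Θ B₁ δ₀ ≤ μ / 2`. [folklore] -/
theorem kappa_bound : S.κ + S.Θ * S.B₁ * S.δ₀ ≤ S.μ / 2 := by
  have hm : (0 : ℝ) < S.m := by exact_mod_cast S.hm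
  have hc := S.hc
  have heq : S.κ + S.Θ * S.B₁ * S.δ₀ =
      (S.Θ * (S.B₁ : ℝ) * (S.B₁ : ℝ) + ((n : ℝ) + 1) * ((n : ℝ) + 1) * (S.B₂ : ℝ) / S.c / S.c) / S.m := by
    unfold κ κ₂ δ₀
    field_simp
    ring
  rw [heq]
  exact S.hm_K

/-- **The bent model is an immersion on the simplex** (Munkres 8.8): its derivative is injective on
the direction space. [cite: Munkres1966, Theorem 8.8] -/
theorem bt_injective {s t : Finset (Fin N → ℝ)} (hs : s ∈ I.Top) (ht : t ∈ S.PTop)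
    (hts : convexHull ℝ (t : Set (Fin N → ℝ)) ⊆ convexHull ℝ (s : Set (Fin N → ℝ)))
    (htZ : convexHull ℝ (t : Set (Fin N → ℝ)) ⊆ I.Zact) {x : Fin N → ℝ}
    (hx : x ∈ convexHull ℝ (t : Set (Fin N → ℝ))) :
    ∃ B' : (Fin N → ℝ) →L[ℝ] 𝔼 n, HasFDerivAt (S.Bt s t ht.1) B' x ∧
      ∀ u ∈ vectorSpan ℝ (t : Set (Fin N → ℝ)), B' u = 0 → u = 0 := by
  obtain ⟨hQ, hO⟩ := S.active_subset hs hts htZ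
  have hmod := S.hmodel s hs
  have hGd : HasFDerivAt (S.G s) (fderiv ℝ (S.G s) x) x :=
    ((hmod.2.2.1.contDiffAt (hmod.1.mem_nhds (hO hx))).differentiableAt (by simp)).hasFDerivAt
  have hθd : HasFDerivAt I.θ (fderiv ℝ I.θ (S.G s x)) (S.G s x) :=
    (I.hθ.contDiffAt.differentiableAt (by simp)).hasFDerivAt
  refine ⟨_, hasFDerivAt_bend (S.A t ht.1) hGd hθd, ?_⟩
  have hxQ : x ∈ convexHull ℝ (s : Set (Fin N → ℝ)) ∩ I.Zact := ⟨hts hx, htZ hx⟩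
  refine injOn_of_norm_sub_le (G' := fderiv ℝ (S.G s) x) (μ := S.μ) (κ'' := S.κ + S.Θ * S.B₁ * S.δ₀)
    (fun u hu => ?_) (fun u hu => ?_) ?_
  · exact hmod.2.2.2.2.2.2.2.1 x hxQ u (vectorSpan_le_of_subset hts hu)
  · exact norm_bend_fderiv_sub_le (I.hθ01 _).1 (I.hθ01 _).2 (S.hΘb _) (hmod.2.2.2.2.2.1 x hxQ)
      (S.norm_A_sub_G_le hs ht.1 hts htZ hx) (fun u hu => S.norm_linear_sub_le hs ht hts htZ hx hu) hu
  · linarith [S.kappa_bound, S.hμ]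

/-! ### Part E2: the bent map and its pointwise properties -/

/-- Every point of the underlying space lies in a top simplex of the refinement. [folklore] -/
theorem exists_PTop_of_mem_space {x : Fin N → ℝ} (hx : x ∈ I.K.space) :
    ∃ t ∈ S.PTop, x ∈ convexHull ℝ (t : Set (Fin N → ℝ)) := by
  rw [← S.P_space] at hx
  obtain ⟨r, hr, hxr⟩ := Geometry.SimplicialComplex.mem_space_iff.1 hx
  obtain ⟨t, ht, hrt, hcard⟩ := S.exists_subset_card_of_mem_P hr
  exact ⟨t, ⟨ht, hcard⟩, convexHull_mono (by exact_mod_cast hrt) hxr⟩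

/-- The margin `η' = min η εreq / 4` is at most `η / 4`. [folklore] -/
theorem eta'_le (I : BendInput n N M) : min I.η I.εreq / 4 ≤ I.η / 4 := by
  have := min_le_left I.η I.εreq
  linarith

/-- The image-modulus `η₀ = min (min η εreq / 4) (ρP / 4)` of `exists_tau`. [folklore] -/
def η₀ : ℝ := min (min I.η I.εreq / 4) (S.ρP / 4)

/-- Auxiliary step of the bending construction (`η₀_nonneg`). [folklore] -/
theorem η₀_nonneg : 0 ≤ S.η₀ := by
  have := lt_min I.hη I.hεreq
  have := S.hρP
  unfold η₀
  exact le_min (by positivity) (by positivity)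

/-- Auxiliary step of the bending construction (`η₀_le`). [folklore] -/
theorem η₀_le : S.η₀ ≤ I.η / 4 := (min_le_left _ _).trans (eta'_le I)

/-- Auxiliary step of the bending construction (`η₀_le_εreq`). [folklore] -/
theorem η₀_le_εreq : S.η₀ ≤ I.εreq / 4 := by
  have := min_le_right I.η I.εreq
  have h : S.η₀ ≤ min I.η I.εreq / 4 := min_le_left _ _
  linarith

/-- Auxiliary step of the bending construction (`η₀_le_ρP`). [folklore] -/
theorem η₀_le_ρP : S.η₀ ≤ S.ρP / 4 := min_le_right _ _

/-- `hτb` restated with `η₀`. [folklore] -/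
theorem hτb' : ∀ x ∈ zone I.K I.f I.e I.R₄, ∀ y ∈ I.K.space, dist y x ≤ S.τ →
    y ∈ I.D ∧ dist (I.F y) (I.F x) ≤ S.η₀ := S.hτb

/-- **Simplices of the refinement near `R₃` are active**: a closed simplex of the refinement
meeting the zone of `cthickening a R₃` with `a + η/4 ≤ η` lies in the active region. [folklore] -/
theorem subset_Zact_of_meets {t : Finset (Fin N → ℝ)} (ht : t ∈ S.P.faces) {a : ℝ} (ha0 : 0 ≤ a)
    (ha : a + I.η / 4 ≤ I.η)
    (hmeet : (convexHull ℝ (t : Set (Fin N → ℝ)) ∩ zone I.K I.f I.e (cthickening a I.R₃)).Nonempty) :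
    convexHull ℝ (t : Set (Fin N → ℝ)) ⊆ I.Zact := by
  have hη4 : 0 ≤ S.η₀ := S.η₀_nonneg
  have hsub1 : cthickening a I.R₃ ⊆ I.R₄ :=
    (cthickening_mono (by linarith [I.hη]) _).trans I.h34
  have hsub2 : cthickening S.η₀ (cthickening a I.R₃) ⊆ I.R₄ :=
    ((cthickening_cthickening_subset hη4 ha0 _).trans (cthickening_mono (by linarith [S.η₀_le]) _)).trans I.h34
  have h := I.subset_zone_of_small S.hτb'
    (fun x hx => (Geometry.SimplicialComplex.convexHull_subset_space ht hx |> fun h => by rwa [S.P_space] at h))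
    (fun x hx y hy => S.dist_le_tau_of_mem_P ht hy hx) hsub1 (hsub2.trans I.hR₄t) hmeet
  exact h.trans (zone_mono hsub2)

/-- **The bent chart-image map** `B = F + (θ ∘ F) • (Λ - F)`. [folklore] -/
def Bmap : (Fin N → ℝ) → 𝔼 n := fun x => I.F x + I.θ (I.F x) • (S.Λ x - I.F x)

open Classical in
/-- **The bent map** `f'`: `e.symm ∘ B` on `D = K.space ∩ f ⁻¹' e.source`, and `f` elsewhere.
Munkres (1966), 10.3 (the map `h⁻¹ G`). [cite: Munkres1966, Corollary 10.3] -/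
def fbend : (Fin N → ℝ) → M := fun x => if x ∈ I.D then I.e.symm (S.Bmap x) else I.f x

/-- Off `D` the bent map is `f`. [folklore] -/
theorem fbend_of_notMem {x : Fin N → ℝ} (hx : x ∉ I.D) : S.fbend x = I.f x := by
  simp [fbend, hx]

/-- On `D` the bent map is `e.symm ∘ B`. [folklore] -/
theorem fbend_of_mem {x : Fin N → ℝ} (hx : x ∈ I.D) : S.fbend x = I.e.symm (S.Bmap x) := by
  simp [fbend, hx]

/-- Where the cut-off vanishes, `B = F`. [folklore] -/
theorem Bmap_eq_F {x : Fin N → ℝ} (hθ : I.θ (I.F x) = 0) : S.Bmap x = I.F x := by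
  simp [Bmap, hθ]

/-- Where the cut-off vanishes, `f' = f`. [folklore] -/
theorem fbend_eq_f_of_theta {x : Fin N → ℝ} (hθ : I.θ (I.F x) = 0) : S.fbend x = I.f x := by
  by_cases hx : x ∈ I.D
  · rw [S.fbend_of_mem hx, S.Bmap_eq_F hθ]
    exact I.e.left_inv hx.2
  · exact S.fbend_of_notMem hx

/-- `f' = f` at points of `D` whose chart image is outside `R₃`. [folklore] -/
theorem fbend_eq_f_of_notMem_R₃ {x : Fin N → ℝ} (hx : I.F x ∉ I.R₃) : S.fbend x = I.f x :=
  S.fbend_eq_f_of_theta (I.hθ0 _ hx)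

/-- **`C⁰` displacement**: `‖B x - F x‖ ≤ δ₀` on `D`. [folklore] -/
theorem norm_Bmap_sub_F_le {x : Fin N → ℝ} (hx : x ∈ I.D) : ‖S.Bmap x - I.F x‖ ≤ S.δ₀ := by
  by_cases hθ : I.θ (I.F x) = 0
  · rw [S.Bmap_eq_F hθ, sub_self, norm_zero]; exact S.δ₀_nonneg
  · -- `F x ∈ R₃`, so the top simplices through `x` are active
    have hx3 : I.F x ∈ I.R₃ := by by_contra h; exact hθ (I.hθ0 _ h)
    obtain ⟨t, ht, hxt⟩ := S.exists_PTop_of_mem_space hx.1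
    obtain ⟨s, hs, hts⟩ := S.exists_top_of_mem_P ht.1
    have hxZ : x ∈ zone I.K I.f I.e (cthickening 0 I.R₃) := by
      rw [cthickening_zero, I.mem_zone_iff_F (I.hR₃.isClosed.closure_eq.symm ▸ I.R₃t)]
      rw [I.hR₃.isClosed.closure_eq]
      exact ⟨hx, hx3⟩
    have htZ : convexHull ℝ (t : Set (Fin N → ℝ)) ⊆ I.Zact :=
      S.subset_Zact_of_meets ht.1 le_rfl (by linarith [I.hη]) ⟨x, hxt, hxZ⟩
    have h1 : S.Λ x = S.A t ht.1 x := S.Λ_eqOn ht.1 hxt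
    have h2 : I.F x = S.G s x := S.F_eq_G hs (hts hxt) hx
    have hθ1 : |I.θ (I.F x)| ≤ 1 := abs_le.2 ⟨by linarith [(I.hθ01 (I.F x)).1], (I.hθ01 (I.F x)).2⟩
    calc ‖S.Bmap x - I.F x‖ = ‖I.θ (I.F x) • (S.Λ x - I.F x)‖ := by simp [Bmap]
      _ = |I.θ (I.F x)| * ‖S.A t ht.1 x - S.G s x‖ := by rw [norm_smul, Real.norm_eq_abs, h1, h2]
      _ ≤ 1 * S.δ₀ := mul_le_mul hθ1 (S.norm_A_sub_G_le hs ht.1 hts htZ hxt) (norm_nonneg _) zero_le_one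
      _ = S.δ₀ := one_mul _

/-- `δ₀ ≤ η / 32 ≤ η`. [folklore] -/
theorem δ₀_le_eta : S.δ₀ ≤ I.η / 32 := by
  have h := S.δ₀_le
  have : min (S.ρP / 4) (I.η / 8) / 8 ≤ I.η / 8 / 8 := by
    have := min_le_right (S.ρP / 4) (I.η / 8); linarith
  linarith [I.hη]

/-- **`B` maps `D` into the chart target**: either `B x = F x`, or `F x ∈ R₃` and `B x ∈ R₄`.
[folklore] -/
theorem Bmap_mem {x : Fin N → ℝ} (hx : x ∈ I.D) :
    S.Bmap x ∈ I.e.target ∧ (S.Bmap x = I.F x ∨ (I.F x ∈ I.R₃ ∧ S.Bmap x ∈ I.R₄)) := by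
  by_cases hθ : I.θ (I.F x) = 0
  · rw [S.Bmap_eq_F hθ]
    exact ⟨I.e.map_source hx.2, Or.inl rfl⟩
  · have hx3 : I.F x ∈ I.R₃ := by by_contra h; exact hθ (I.hθ0 _ h)
    have h4 : S.Bmap x ∈ I.R₄ := by
      refine I.h34 (mem_cthickening_of_dist_le _ (I.F x) _ _ hx3 ?_)
      rw [dist_eq_norm]
      linarith [S.norm_Bmap_sub_F_le hx, S.δ₀_le_eta, I.hη]
    exact ⟨I.hR₄t h4, Or.inr ⟨hx3, h4⟩⟩

/-- **On `D` the bent map lands in the chart source** with `e (f' x) = B x`. [folklore] -/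
theorem fbend_mem_source {x : Fin N → ℝ} (hx : x ∈ I.D) :
    S.fbend x ∈ I.e.source ∧ I.e (S.fbend x) = S.Bmap x := by
  rw [S.fbend_of_mem hx]
  exact ⟨I.e.map_target (S.Bmap_mem hx).1, I.e.right_inv (S.Bmap_mem hx).1⟩

/-- **`C⁰` closeness of `f'` to `f` in the chart**: `‖e (f' x) - e (f x)‖ ≤ δ₀` on `D`. [folklore] -/
theorem norm_e_fbend_sub_le {x : Fin N → ℝ} (hx : x ∈ I.D) : ‖I.e (S.fbend x) - I.F x‖ ≤ S.δ₀ := by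
  rw [(S.fbend_mem_source hx).2]
  exact S.norm_Bmap_sub_F_le hx

/-! ### Part E3: the chart-level map `g = id + θ • w` -/

/-- The inverse of `F` on `D`. [folklore] -/
def _root_.Literature.Topology.FourManifolds.BendInput.Finv (I : BendInput n N M) : 𝔼 n → (Fin N → ℝ) :=
  Function.invFunOn I.F I.D

/-- Auxiliary step of the bending construction (`Finv_F`). [folklore] -/
theorem _root_.Literature.Topology.FourManifolds.BendInput.Finv_F (I : BendInput n N M) {x : Fin N → ℝ}
    (hx : x ∈ I.D) : I.Finv (I.F x) = x :=
  I.injOn_F.leftInvOn_invFunOn hx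

/-- The displacement `w z = Λ (F⁻¹ z) - z`. [folklore] -/
def wfun : 𝔼 n → 𝔼 n := fun z => S.Λ (I.Finv z) - z

/-- **The chart-level bending map** `g = id + θ • w` (Munkres 10.2: the map carrying `h f` to
`h f'`). [cite: Munkres1966, Lemma 10.2] -/
def g : 𝔼 n → 𝔼 n := fun z => z + I.θ z • S.wfun z

/-- Auxiliary step of the bending construction (`wfun_F`). [folklore] -/
theorem wfun_F {x : Fin N → ℝ} (hx : x ∈ I.D) : S.wfun (I.F x) = S.Λ x - I.F x := by
  simp [wfun, I.Finv_F hx]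

/-- `g ∘ F = B` on `D`. [folklore] -/
theorem g_F {x : Fin N → ℝ} (hx : x ∈ I.D) : S.g (I.F x) = S.Bmap x := by
  simp [g, Bmap, S.wfun_F hx]

/-- **`g` moves points of `Y` by at most `δ₀`.** [folklore] -/
theorem norm_g_sub_le {z : 𝔼 n} (hz : z ∈ I.Y) : ‖S.g z - z‖ ≤ S.δ₀ := by
  obtain ⟨x, hx, rfl⟩ := hz
  rw [S.g_F hx]
  exact S.norm_Bmap_sub_F_le hx

/-- `g = id` off `R₃`. [folklore] -/
theorem g_eq_self {z : 𝔼 n} (hz : z ∉ I.R₃) : S.g z = z := by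
  simp [g, I.hθ0 z hz]

/-- The displacement constant `εw = (κ₂ + B₂/m) / μ'`. [folklore] -/
def εw : ℝ := (S.κ₂ + S.B₂ / S.m) / S.μ'

/-- The Lipschitz constant `ε' = Θ δ₀ + εw` of `g - id` on active pieces. [folklore] -/
def ε' : ℝ := S.Θ * S.δ₀ + S.εw

/-- Auxiliary step of the bending construction (`ε'_nonneg`). [folklore] -/
theorem ε'_nonneg : 0 ≤ S.ε' := by
  have := S.hμ'; have := S.hΘ; have := S.δ₀_nonneg; have := S.κ₂_nonneg
  unfold ε' εw; positivity

/-- **`ε' ≤ 1/4`.** [folklore] -/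
theorem ε'_le : S.ε' ≤ 1 / 4 := by
  have hm : (0 : ℝ) < S.m := by exact_mod_cast S.hm
  have hc := S.hc
  have hμ' := S.hμ'
  have heq : S.ε' = ((((n : ℝ) + 1) * (S.B₂ : ℝ) / S.c + (S.B₂ : ℝ)) / S.μ' + S.Θ * (S.B₁ : ℝ)) / S.m := by
    unfold ε' εw κ₂ δ₀
    field_simp
    ring
  rw [heq]
  exact S.hm_A

/-- The cut-off is `Θ`-Lipschitz. [folklore] -/
theorem theta_lipschitz (z z' : 𝔼 n) : ‖I.θ z - I.θ z'‖ ≤ S.Θ * ‖z - z'‖ := by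
  have h : LipschitzWith ⟨S.Θ, S.hΘ⟩ I.θ :=
    lipschitzWith_of_nnnorm_fderiv_le (I.hθ.differentiable (by simp)) fun y => by
      show ‖fderiv ℝ I.θ y‖ ≤ S.Θ
      exact S.hΘb y
  have := h.dist_le_mul z z'
  rwa [dist_eq_norm, dist_eq_norm] at this

/-- **`g - id` is `ε'`-Lipschitz on an active image piece** `F '' convexHull t`. [folklore] -/
theorem lipschitz_piece {s t : Finset (Fin N → ℝ)} (hs : s ∈ I.Top) (ht : t ∈ S.PTop)
    (hts : convexHull ℝ (t : Set (Fin N → ℝ)) ⊆ convexHull ℝ (s : Set (Fin N → ℝ)))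
    (htZ : convexHull ℝ (t : Set (Fin N → ℝ)) ⊆ I.Zact) :
    LipschitzOnWith ⟨S.ε', S.ε'_nonneg⟩ (fun z => S.g z - z) (I.F '' convexHull ℝ (t : Set (Fin N → ℝ))) := by
  classical
  obtain ⟨hQ, hO⟩ := S.active_subset hs hts htZ
  have hmod := S.hmodel s hs
  have hQ' : convexHull ℝ (t : Set (Fin N → ℝ)) ⊆ convexHull ℝ (s : Set (Fin N → ℝ)) ∩ I.Zact :=
    subset_inter hts htZ
  have hD : convexHull ℝ (t : Set (Fin N → ℝ)) ⊆ I.D := fun x hx => I.Zact_subset_D (htZ hx)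
  -- on the piece, `F = G s`
  have hFG : ∀ x ∈ convexHull ℝ (t : Set (Fin N → ℝ)), I.F x = S.G s x := fun x hx => S.F_eq_G hs (hts hx) (hD hx)
  have hpiece : I.F '' convexHull ℝ (t : Set (Fin N → ℝ)) = S.G s '' convexHull ℝ (t : Set (Fin N → ℝ)) :=
    image_congr fun x hx => hFG x hx
  -- the displacement on the piece
  have hw : ∀ x ∈ convexHull ℝ (t : Set (Fin N → ℝ)), S.wfun (S.G s x) = S.A t ht.1 x - S.G s x := fun x hx => by
    rw [← hFG x hx, S.wfun_F (hD hx), S.Λ_eqOn ht.1 hx]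
  have hAv : ∀ v ∈ t, S.A t ht.1 v = S.G s v := fun v hv => by
    rw [S.A_apply_of_mem ht.1 hv]; exact hFG v (subset_convexHull ℝ _ hv)
  have hdiff : ∀ z ∈ convexHull ℝ (t : Set (Fin N → ℝ)),
      HasFDerivWithinAt (S.G s) (fderiv ℝ (S.G s) z) (convexHull ℝ (t : Set (Fin N → ℝ))) z := fun z hz =>
    ((hmod.2.2.1.contDiffAt (hmod.1.mem_nhds (hO hz))).differentiableAt (by simp)).hasFDerivAt.hasFDerivWithinAt
  have hLipD := ((hmod.2.2.2.2.2.2.1 _ (convex_convexHull ℝ _) hQ').2)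
  have hdiam : ∀ u ∈ t, ∀ u' ∈ t, ‖u - u'‖ ≤ 1 / (S.m : ℝ) := fun u hu u' hu' => by
    rw [← dist_eq_norm]
    exact S.dist_le_of_mem_P ht.1 (subset_convexHull ℝ _ hu) (subset_convexHull ℝ _ hu')
  have hbi : ∀ x ∈ convexHull ℝ (t : Set (Fin N → ℝ)), ∀ y ∈ convexHull ℝ (t : Set (Fin N → ℝ)),
      S.μ' * ‖y - x‖ ≤ ‖S.G s y - S.G s x‖ := fun x hx y hy =>
    hmod.2.2.2.2.2.2.2.2 y ⟨hts hy, htZ hy⟩ x ⟨hts hx, htZ hx⟩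
  have hδ : (0 : ℝ) ≤ 1 / (S.m : ℝ) := by positivity
  have hdisp := lipschitzOnWith_displacement hAv S.hc (S.nondegenerate_of_mem_P ht.1) hδ hdiam hdiff hLipD
    S.hμ' hbi hw
  have hcard : (t.card : ℝ) = (n : ℝ) + 1 := by rw [ht.2]; push_cast; ring
  -- the Lipschitz estimate
  refine LipschitzOnWith.of_dist_le_mul fun q hq p hp => ?_
  rw [hpiece] at hq hp
  have hwq : ‖S.wfun q‖ ≤ S.δ₀ := by
    obtain ⟨y, hy, rfl⟩ := hq
    rw [hw y hy]; exact S.norm_A_sub_G_le hs ht.1 hts htZ hy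
  have hθp : |I.θ p| ≤ 1 := abs_le.2 ⟨by linarith [(I.hθ01 p).1], (I.hθ01 p).2⟩
  have hwlip : ‖S.wfun q - S.wfun p‖ ≤ S.εw * ‖q - p‖ := by
    have h := hdisp p hp q hq
    rw [hcard] at h
    refine h.trans (le_of_eq ?_)
    unfold εw κ₂
    ring
  have hεw0 : 0 ≤ S.εw := by have := S.hμ'; have := S.κ₂_nonneg; unfold εw; positivity
  rw [dist_eq_norm, dist_eq_norm]
  show ‖(S.g q - q) - (S.g p - p)‖ ≤ S.ε' * ‖q - p‖
  have hid : (S.g q - q) - (S.g p - p) = (I.θ q - I.θ p) • S.wfun q + I.θ p • (S.wfun q - S.wfun p) := by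
    simp only [g, add_sub_cancel_left, sub_smul, smul_sub]; abel
  rw [hid]
  calc ‖(I.θ q - I.θ p) • S.wfun q + I.θ p • (S.wfun q - S.wfun p)‖
      ≤ ‖(I.θ q - I.θ p) • S.wfun q‖ + ‖I.θ p • (S.wfun q - S.wfun p)‖ := norm_add_le _ _
    _ ≤ S.Θ * ‖q - p‖ * S.δ₀ + 1 * (S.εw * ‖q - p‖) := by
        rw [norm_smul, norm_smul, Real.norm_eq_abs, Real.norm_eq_abs]
        refine add_le_add (mul_le_mul ?_ hwq (norm_nonneg _) (by have := S.hΘ; positivity))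
          (mul_le_mul hθp hwlip (norm_nonneg _) zero_le_one)
        rw [← Real.norm_eq_abs]; exact S.theta_lipschitz q p
    _ = S.ε' * ‖q - p‖ := by unfold ε'; ring

/-! ### Part E4: good balls, the trimmed complex, injectivity -/

/-- The active top simplices of the refinement. [folklore] -/
def ActTop : Set (Finset (Fin N → ℝ)) := {t | t ∈ S.PTop ∧ ∃ s ∈ I.Top,
  convexHull ℝ (t : Set (Fin N → ℝ)) ⊆ convexHull ℝ (s : Set (Fin N → ℝ)) ∧
    convexHull ℝ (t : Set (Fin N → ℝ)) ⊆ I.Zact}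

/-- Auxiliary step of the bending construction (`actTop_finite`). [folklore] -/
theorem actTop_finite : S.ActTop.Finite := S.P_finite.subset fun _ ht => ht.1.1

/-- Active image pieces are closed (compact). [folklore] -/
theorem isClosed_piece {t : Finset (Fin N → ℝ)} (ht : t ∈ S.ActTop) :
    IsClosed (I.F '' convexHull ℝ (t : Set (Fin N → ℝ))) := by
  obtain ⟨-, s, hs, hts, htZ⟩ := ht
  have hD : convexHull ℝ (t : Set (Fin N → ℝ)) ⊆ I.D := fun x hx => I.Zact_subset_D (htZ hx)
  exact ((t.finite_toSet.isCompact_convexHull ℝ).image_of_continuousOn (I.continuousOn_F.mono hD)).isClosed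

/-- The good ball radius `ρ₀ = min (ρP / 4) (η / 8)`. [folklore] -/
def ρ₀ : ℝ := min (S.ρP / 4) (I.η / 8)

/-- Auxiliary step of the bending construction (`ρ₀_pos`). [folklore] -/
theorem ρ₀_pos : 0 < S.ρ₀ := lt_min (by linarith [S.hρP]) (by linarith [I.hη])

/-- Auxiliary step of the bending construction (`ρ₀_le_ρP`). [folklore] -/
theorem ρ₀_le_ρP : S.ρ₀ ≤ S.ρP / 4 := min_le_left _ _

/-- Auxiliary step of the bending construction (`ρ₀_le_eta`). [folklore] -/
theorem ρ₀_le_eta : S.ρ₀ ≤ I.η / 8 := min_le_right _ _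

/-- Auxiliary step of the bending construction (`δ₀_le_ρ₀`). [folklore] -/
theorem δ₀_le_ρ₀ : S.δ₀ ≤ S.ρ₀ / 8 := S.δ₀_le

/-- **Points of `Y` near `R₃` lie in active pieces.** [folklore] -/
theorem exists_actTop_of_mem_Y {z : 𝔼 n} (hz : z ∈ I.Y) (hz3 : z ∈ cthickening (5 * I.η / 8) I.R₃) :
    ∃ t ∈ S.ActTop, z ∈ I.F '' convexHull ℝ (t : Set (Fin N → ℝ)) := by
  obtain ⟨x, hx, rfl⟩ := hz
  obtain ⟨t, ht, hxt⟩ := S.exists_PTop_of_mem_space hx.1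
  obtain ⟨s, hs, hts⟩ := S.exists_top_of_mem_P ht.1
  have h38 : cthickening (5 * I.η / 8) I.R₃ ⊆ I.e.target :=
    ((cthickening_mono (by linarith [I.hη]) _).trans I.h34).trans I.hR₄t
  have hxZ : x ∈ zone I.K I.f I.e (cthickening (5 * I.η / 8) I.R₃) :=
    (I.mem_zone_iff_F h38).2 ⟨hx, hz3⟩
  have htZ : convexHull ℝ (t : Set (Fin N → ℝ)) ⊆ I.Zact :=
    S.subset_Zact_of_meets ht.1 (by linarith [I.hη]) (by linarith [I.hη]) ⟨x, hxt, hxZ⟩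
  exact ⟨t, ⟨ht, s, hs, hts, htZ⟩, x, hxt, rfl⟩

/-- **`g - id` is `ε'`-Lipschitz on good balls.** [folklore] -/
theorem lipschitz_ball {z₀ : 𝔼 n} (hz₀ : z₀ ∈ cthickening (I.η / 2) I.R₃)
    (hball : closedBall z₀ S.ρ₀ ⊆ I.Y) :
    LipschitzOnWith ⟨S.ε', S.ε'_nonneg⟩ (fun z => S.g z - z) (closedBall z₀ S.ρ₀) := by
  haveI : Finite S.ActTop := S.actTop_finite.to_subtype
  refine lipschitzOnWith_of_convex_subset_iUnion (ι := S.ActTop)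
    (A := fun t => I.F '' convexHull ℝ ((t : Finset (Fin N → ℝ)) : Set (Fin N → ℝ)))
    (fun t => S.isClosed_piece t.2) (fun t => ?_) (convex_closedBall z₀ S.ρ₀) fun z hz => ?_
  · obtain ⟨ht, s, hs, hts, htZ⟩ := t.2
    exact S.lipschitz_piece hs ht hts htZ
  · have hz3 : z ∈ cthickening (5 * I.η / 8) I.R₃ := by
      have hρ : S.ρ₀ ≤ I.η / 8 := S.ρ₀_le_eta
      have : z ∈ cthickening S.ρ₀ (cthickening (I.η / 2) I.R₃) :=
        mem_cthickening_of_dist_le _ _ _ _ hz₀ (mem_closedBall.1 hz)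
      have h2 := cthickening_cthickening_subset S.ρ₀_pos.le (by linarith [I.hη]) I.R₃ this
      exact cthickening_mono (by linarith) _ h2
    obtain ⟨t, ht, hzt⟩ := S.exists_actTop_of_mem_Y (hball hz) hz3
    exact mem_iUnion.2 ⟨⟨t, ht⟩, hzt⟩

/-- **`g` approximates the identity on good balls.** [folklore] -/
theorem approx_ball {z₀ : 𝔼 n} (hz₀ : z₀ ∈ cthickening (I.η / 2) I.R₃)
    (hball : closedBall z₀ S.ρ₀ ⊆ I.Y) :
    ApproximatesLinearOn S.g ((ContinuousLinearEquiv.refl ℝ (𝔼 n) : 𝔼 n ≃L[ℝ] 𝔼 n) : 𝔼 n →L[ℝ] 𝔼 n)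
      (closedBall z₀ S.ρ₀) ⟨S.ε', S.ε'_nonneg⟩ := by
  rw [ApproximatesLinearOn.approximatesLinearOn_iff_lipschitzOnWith]
  have : (S.g - ⇑((ContinuousLinearEquiv.refl ℝ (𝔼 n) : 𝔼 n ≃L[ℝ] 𝔼 n) : 𝔼 n →L[ℝ] 𝔼 n)) =
      fun z => S.g z - z := by
    funext z; simp
  rw [this]
  exact S.lipschitz_ball hz₀ hball

/-- The constant of the inverse function theorem is fine: `Subsingleton ∨ ε' < N⁻¹`. [folklore] -/
theorem hc_refl : Subsingleton (𝔼 n) ∨ (⟨S.ε', S.ε'_nonneg⟩ : ℝ≥0) <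
    ‖((ContinuousLinearEquiv.refl ℝ (𝔼 n)).symm : 𝔼 n →L[ℝ] 𝔼 n)‖₊⁻¹ := by
  rcases subsingleton_or_nontrivial (𝔼 n) with h | h
  · exact Or.inl h
  · right
    have hN : ‖((ContinuousLinearEquiv.refl ℝ (𝔼 n)).symm : 𝔼 n →L[ℝ] 𝔼 n)‖₊ = 1 := by
      rw [ContinuousLinearEquiv.refl_symm, ContinuousLinearEquiv.coe_refl]
      exact ContinuousLinearMap.nnnorm_id
    rw [hN, inv_one]
    show S.ε' < 1
    linarith [S.ε'_le]

/-- **`g` is injective on good balls.** [folklore] -/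
theorem injOn_ball {z₀ : 𝔼 n} (hz₀ : z₀ ∈ cthickening (I.η / 2) I.R₃)
    (hball : closedBall z₀ S.ρ₀ ⊆ I.Y) : InjOn S.g (closedBall z₀ S.ρ₀) :=
  (S.approx_ball hz₀ hball).injOn S.hc_refl

/-! ### Part E5: the trimmed complex and injectivity of the bent map -/

/-- A point is *good* if, whenever it lies in `D` with chart image near `R₃`, the good ball about
its chart image lies in `Y` (Munkres' "distance from the frontier" condition, localised).
[folklore] -/
def Good (x : Fin N → ℝ) : Prop :=
  x ∈ I.D → I.F x ∈ cthickening (I.η / 4) I.R₃ → closedBall (I.F x) S.ρ₀ ⊆ I.Y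

/-- The kept top simplices: those all of whose points are good. [folklore] -/
def KeptTop : Set (Finset (Fin N → ℝ)) := {t | t ∈ S.PTop ∧ ∀ x ∈ convexHull ℝ (t : Set (Fin N → ℝ)), S.Good x}

/-- The faces of the trimmed complex: faces of kept top simplices. [folklore] -/
def KbFaces : Set (Finset (Fin N → ℝ)) := {r | r ∈ S.P.faces ∧ ∃ t ∈ S.KeptTop, r ⊆ t}

/-- Auxiliary step of the bending construction (`kbFaces_subset`). [folklore] -/
theorem kbFaces_subset : S.KbFaces ⊆ S.P.faces := fun _ hr => hr.1

/-- Auxiliary step of the bending construction (`kbFaces_down`). [folklore] -/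
theorem kbFaces_down : ∀ r ∈ S.KbFaces, ∀ r' ⊆ r, r'.Nonempty → r' ∈ S.KbFaces :=
  fun _ hr _ hr' hne => ⟨S.P.down_closed hr.1 hr' hne, hr.2.imp fun _ ht => ⟨ht.1, hr'.trans ht.2⟩⟩

/-- **The trimmed complex** `K''`: the pure subcomplex of the refinement on the kept top
simplices. [folklore] -/
def Kb : Geometry.SimplicialComplex ℝ (Fin N → ℝ) := subcomplexOf S.P S.KbFaces S.kbFaces_subset S.kbFaces_down

/-- Auxiliary step of the bending construction (`mem_Kb_faces`). [folklore] -/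
theorem mem_Kb_faces {r : Finset (Fin N → ℝ)} : r ∈ S.Kb.faces ↔ r ∈ S.P.faces ∧ ∃ t ∈ S.KeptTop, r ⊆ t :=
  Iff.rfl

/-- Kept top simplices are faces of the trimmed complex. [folklore] -/
theorem mem_Kb_of_keptTop {t : Finset (Fin N → ℝ)} (ht : t ∈ S.KeptTop) : t ∈ S.Kb.faces :=
  ⟨ht.1.1, t, ht, Finset.Subset.refl t⟩

/-- Auxiliary step of the bending construction (`Kb_finite`). [folklore] -/
theorem Kb_finite : S.Kb.faces.Finite := S.P_finite.subset S.kbFaces_subset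

/-- **The trimmed complex is pure.** [folklore] -/
theorem Kb_pure {r : Finset (Fin N → ℝ)} (hr : r ∈ S.Kb.faces) :
    ∃ t ∈ S.Kb.faces, r ⊆ t ∧ t.card = n + 1 := by
  obtain ⟨-, t, ht, hrt⟩ := hr
  exact ⟨t, S.mem_Kb_of_keptTop ht, hrt, ht.1.2⟩

/-- The trimmed complex lies in the refinement, hence in `K.space`. [folklore] -/
theorem Kb_space_subset : S.Kb.space ⊆ I.K.space := fun x hx => by
  obtain ⟨r, hr, hxr⟩ := Geometry.SimplicialComplex.mem_space_iff.1 hx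
  rw [← S.P_space]
  exact S.P.convexHull_subset_space hr.1 hxr

/-- Every point of the trimmed complex lies in a kept top simplex. [folklore] -/
theorem exists_keptTop_of_mem_Kb_space {x : Fin N → ℝ} (hx : x ∈ S.Kb.space) :
    ∃ t ∈ S.KeptTop, x ∈ convexHull ℝ (t : Set (Fin N → ℝ)) := by
  obtain ⟨r, ⟨-, t, ht, hrt⟩, hxr⟩ := Geometry.SimplicialComplex.mem_space_iff.1 hx
  exact ⟨t, ht, convexHull_mono (by exact_mod_cast hrt) hxr⟩

/-- **Points of the trimmed complex are good.** [folklore] -/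
theorem good_of_mem_Kb_space {x : Fin N → ℝ} (hx : x ∈ S.Kb.space) : S.Good x := by
  obtain ⟨t, ht, hxt⟩ := S.exists_keptTop_of_mem_Kb_space hx
  exact ht.2 x hxt

/-- The key injectivity step: if `x` is a good point of `D` with `θ (F x) ≠ 0` and
`g (F x) = g (F y)` for `y ∈ D`, then `x = y`. [folklore] -/
theorem eq_of_g_eq {x y : Fin N → ℝ} (hx : x ∈ I.D) (hy : y ∈ I.D) (hgood : S.Good x)
    (hθ : I.θ (I.F x) ≠ 0) (hg : S.g (I.F x) = S.g (I.F y)) : x = y := by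
  have hx3 : I.F x ∈ I.R₃ := by by_contra h; exact hθ (I.hθ0 _ h)
  have hz₀ : I.F x ∈ cthickening (I.η / 4) I.R₃ := self_subset_cthickening _ hx3
  have hz₀' : I.F x ∈ cthickening (I.η / 2) I.R₃ := self_subset_cthickening _ hx3
  have hball : closedBall (I.F x) S.ρ₀ ⊆ I.Y := hgood hx hz₀
  -- `F y` is within `2 δ₀ ≤ ρ₀ / 2` of `F x`
  have hclose : dist (I.F y) (I.F x) ≤ 2 * S.δ₀ := by
    have h1 := S.norm_g_sub_le ⟨x, hx, rfl⟩
    have h2 := S.norm_g_sub_le ⟨y, hy, rfl⟩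
    rw [dist_eq_norm]
    calc ‖I.F y - I.F x‖ = ‖(S.g (I.F x) - I.F x) - (S.g (I.F y) - I.F y)‖ := by rw [hg]; congr 1; abel
      _ ≤ ‖S.g (I.F x) - I.F x‖ + ‖S.g (I.F y) - I.F y‖ := norm_sub_le _ _
      _ ≤ 2 * S.δ₀ := by linarith
  have hyball : I.F y ∈ closedBall (I.F x) S.ρ₀ :=
    mem_closedBall.2 (hclose.trans (by linarith [S.δ₀_le_ρ₀, S.ρ₀_pos]))
  have hxball : I.F x ∈ closedBall (I.F x) S.ρ₀ := mem_closedBall_self S.ρ₀_pos.le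
  have hFeq : I.F x = I.F y := S.injOn_ball hz₀' hball hxball hyball hg
  exact I.injOn_F hx hy hFeq

/-- **Generalised injectivity**: if `f' x = f' y` with `x` in the trimmed complex and `y` anywhere
in `K.space`, then `x = y`. [folklore] -/
theorem eq_of_fbend_eq {x y : Fin N → ℝ} (hx : x ∈ S.Kb.space) (hyK : y ∈ I.K.space)
    (hxy : S.fbend x = S.fbend y) : x = y := by
  have hxK : x ∈ I.K.space := S.Kb_space_subset hx
  by_cases hxD : x ∈ I.D <;> by_cases hyD : y ∈ I.D
  · -- both in `D`: compare `g (F x) = e (f' x) = e (f' y) = g (F y)`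
    have hg : S.g (I.F x) = S.g (I.F y) := by
      rw [S.g_F hxD, S.g_F hyD, ← (S.fbend_mem_source hxD).2, ← (S.fbend_mem_source hyD).2, hxy]
    by_cases hθx : I.θ (I.F x) = 0
    · have h1 : S.g (I.F x) = I.F x := by rw [S.g_F hxD, S.Bmap_eq_F hθx]
      by_cases hθy : I.θ (I.F y) = 0
      · have h2 : S.g (I.F y) = I.F y := by rw [S.g_F hyD, S.Bmap_eq_F hθy]
        exact I.injOn_F hxD hyD (by rw [← h1, ← h2, hg])
      · -- `F x = B y` is within `δ₀` of `F y ∈ R₃`; use the good ball about `F x`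
        have hy3 : I.F y ∈ I.R₃ := by by_contra h; exact hθy (I.hθ0 _ h)
        have hFx : I.F x = S.Bmap y := by rw [← h1, hg, S.g_F hyD]
        have hclose : dist (I.F y) (I.F x) ≤ S.δ₀ := by
          rw [hFx, dist_comm, dist_eq_norm]; exact S.norm_Bmap_sub_F_le hyD
        have hz₀ : I.F x ∈ cthickening (I.η / 4) I.R₃ :=
          mem_cthickening_of_dist_le _ _ _ _ hy3 (by
            rw [dist_comm]; linarith [hclose, S.δ₀_le_eta, I.hη])
        have hz₀' : I.F x ∈ cthickening (I.η / 2) I.R₃ := cthickening_mono (by linarith [I.hη]) _ hz₀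
        have hball : closedBall (I.F x) S.ρ₀ ⊆ I.Y := S.good_of_mem_Kb_space hx hxD hz₀
        have hyball : I.F y ∈ closedBall (I.F x) S.ρ₀ :=
          mem_closedBall.2 (hclose.trans (by linarith [S.δ₀_le_ρ₀, S.ρ₀_pos]))
        have hxball : I.F x ∈ closedBall (I.F x) S.ρ₀ := mem_closedBall_self S.ρ₀_pos.le
        exact I.injOn_F hxD hyD (S.injOn_ball hz₀' hball hxball hyball hg)
    · exact S.eq_of_g_eq hxD hyD (S.good_of_mem_Kb_space hx) hθx hg
  · -- `x ∈ D`, `y ∉ D`: impossible, `f' x ∈ e.source` but `f' y = f y ∉ e.source`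
    exfalso
    have h1 := (S.fbend_mem_source hxD).1
    rw [hxy, S.fbend_of_notMem hyD] at h1
    exact hyD ⟨hyK, h1⟩
  · exfalso
    have h1 := (S.fbend_mem_source hyD).1
    rw [← hxy, S.fbend_of_notMem hxD] at h1
    exact hxD ⟨hxK, h1⟩
  · rw [S.fbend_of_notMem hxD, S.fbend_of_notMem hyD] at hxy
    exact I.inj hxK hyK hxy

/-- **The bent map is injective on the trimmed complex** (Munkres 10.2–10.3: the straightened map is
an imbedding). [cite: Munkres1966, Lemma 10.2] -/
theorem injOn_fbend : InjOn S.fbend S.Kb.space := fun _ hx _ hy hxy =>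
  S.eq_of_fbend_eq hx (S.Kb_space_subset hy) hxy

/-! ### Part F: continuity, smooth models and straightness of the bent map -/

/-- **Dichotomy for top simplices**: a top simplex of the refinement is either active (inside the
active region and a top simplex of `K`) or unbent (`f' = f` on it). [folklore] -/
theorem active_or_unbent {t : Finset (Fin N → ℝ)} (ht : t ∈ S.P.faces) :
    (∃ s ∈ I.Top, convexHull ℝ (t : Set (Fin N → ℝ)) ⊆ convexHull ℝ (s : Set (Fin N → ℝ)) ∧
      convexHull ℝ (t : Set (Fin N → ℝ)) ⊆ I.Zact) ∨
    EqOn S.fbend I.f (convexHull ℝ (t : Set (Fin N → ℝ))) := by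
  by_cases hmeet : (convexHull ℝ (t : Set (Fin N → ℝ)) ∩ zone I.K I.f I.e (cthickening 0 I.R₃)).Nonempty
  · obtain ⟨s, hs, hts⟩ := S.exists_top_of_mem_P ht
    exact Or.inl ⟨s, hs, hts, S.subset_Zact_of_meets ht le_rfl (by linarith [I.hη]) hmeet⟩
  · right
    intro x hx
    by_cases hxD : x ∈ I.D
    · refine S.fbend_eq_f_of_notMem_R₃ fun h3 => hmeet ⟨x, hx, ?_⟩
      rw [cthickening_zero, I.hR₃.isClosed.closure_eq, I.mem_zone_iff_F I.R₃t]
      exact ⟨hxD, h3⟩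
    · exact S.fbend_of_notMem hxD

/-- On an active top simplex, `B = Bt` (the explicit model). [folklore] -/
theorem Bmap_eq_Bt {s t : Finset (Fin N → ℝ)} (hs : s ∈ I.Top) (ht : t ∈ S.P.faces)
    (hts : convexHull ℝ (t : Set (Fin N → ℝ)) ⊆ convexHull ℝ (s : Set (Fin N → ℝ)))
    (htZ : convexHull ℝ (t : Set (Fin N → ℝ)) ⊆ I.Zact) {x : Fin N → ℝ}
    (hx : x ∈ convexHull ℝ (t : Set (Fin N → ℝ))) : S.Bmap x = S.Bt s t ht x := by
  have hxD : x ∈ I.D := I.Zact_subset_D (htZ hx)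
  simp only [Bmap, Bt, S.F_eq_G hs (hts hx) hxD, S.Λ_eqOn ht hx]

/-- On an active top simplex, `e ∘ f' = Bt` and `f'` maps into the chart source. [folklore] -/
theorem fbend_eq_on_active {s t : Finset (Fin N → ℝ)} (hs : s ∈ I.Top) (ht : t ∈ S.P.faces)
    (hts : convexHull ℝ (t : Set (Fin N → ℝ)) ⊆ convexHull ℝ (s : Set (Fin N → ℝ)))
    (htZ : convexHull ℝ (t : Set (Fin N → ℝ)) ⊆ I.Zact) {x : Fin N → ℝ}
    (hx : x ∈ convexHull ℝ (t : Set (Fin N → ℝ))) :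
    S.fbend x ∈ I.e.source ∧ I.e (S.fbend x) = S.Bt s t ht x ∧ S.fbend x = I.e.symm (S.Bt s t ht x) ∧
      S.Bt s t ht x ∈ I.e.target := by
  have hxD : x ∈ I.D := I.Zact_subset_D (htZ hx)
  obtain ⟨hsrc, heq⟩ := S.fbend_mem_source hxD
  have hB := S.Bmap_eq_Bt hs ht hts htZ hx
  refine ⟨hsrc, by rw [heq, hB], by rw [S.fbend_of_mem hxD, hB], ?_⟩
  rw [← hB]; exact (S.Bmap_mem hxD).1

/-- The explicit model is smooth on the domain of the model of the top simplex. [folklore] -/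
theorem contDiffOn_Bt {s t : Finset (Fin N → ℝ)} (hs : s ∈ I.Top) (ht : t ∈ S.P.faces) :
    ContDiffOn ℝ ∞ (S.Bt s t ht) (S.O s) := by
  have hmod := S.hmodel s hs
  have hA : ContDiff ℝ ∞ (S.A t ht : (Fin N → ℝ) → 𝔼 n) := by
    have heq : (S.A t ht : (Fin N → ℝ) → 𝔼 n) = fun y => LinearMap.toContinuousLinearMap (S.A t ht).linear y + S.A t ht 0 := by
      funext y
      have := (S.A t ht).map_vadd 0 y
      rw [vadd_eq_add, add_zero] at this
      rw [this, vadd_eq_add]; rfl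
    rw [heq]
    exact ((LinearMap.toContinuousLinearMap (S.A t ht).linear).contDiff).add contDiff_const
  exact hmod.2.2.1.add (((I.hθ.comp_contDiffOn hmod.2.2.1)).smul (hA.contDiffOn.sub hmod.2.2.1))

/-- **The bent map is continuous on every closed simplex of the refinement.** [folklore] -/
theorem continuousOn_fbend {r : Finset (Fin N → ℝ)} (hr : r ∈ S.P.faces) :
    ContinuousOn S.fbend (convexHull ℝ (r : Set (Fin N → ℝ))) := by
  -- pass to a top coface
  obtain ⟨t, ht, hrt, hcard⟩ := S.exists_subset_card_of_mem_P hr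
  have hsub : convexHull ℝ (r : Set (Fin N → ℝ)) ⊆ convexHull ℝ (t : Set (Fin N → ℝ)) :=
    convexHull_mono (by exact_mod_cast hrt)
  refine ContinuousOn.mono ?_ hsub
  rcases S.active_or_unbent ht with ⟨s, hs, hts, htZ⟩ | hunbent
  · -- active: `f' = e.symm ∘ Bt`
    have heq : EqOn S.fbend (fun x => I.e.symm (S.Bt s t ht x)) (convexHull ℝ (t : Set (Fin N → ℝ))) :=
      fun x hx => (S.fbend_eq_on_active hs ht hts htZ hx).2.2.1
    refine ContinuousOn.congr ?_ heq
    have hBc : ContinuousOn (S.Bt s t ht) (convexHull ℝ (t : Set (Fin N → ℝ))) :=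
      (S.contDiffOn_Bt hs ht).continuousOn.mono (S.active_subset hs hts htZ).2
    exact I.e.continuousOn_symm.comp hBc fun x hx => (S.fbend_eq_on_active hs ht hts htZ hx).2.2.2
  · have hsubK : convexHull ℝ (t : Set (Fin N → ℝ)) ⊆ I.K.space := fun x hx => by
      have h := S.P.convexHull_subset_space ht hx
      rwa [S.P_space] at h
    exact (I.continuousOn_f.mono hsubK).congr hunbent

/-- **Smooth chart model of the bent map on an active top simplex** (WS2 contract (o4), bent
case): `e ∘ f' = Bt` on the closed simplex, `Bt` is `C^∞` on an open set containing it, and its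
derivative is injective on the direction space. [folklore] -/
theorem model_active {s t : Finset (Fin N → ℝ)} (hs : s ∈ I.Top) (ht : t ∈ S.PTop)
    (hts : convexHull ℝ (t : Set (Fin N → ℝ)) ⊆ convexHull ℝ (s : Set (Fin N → ℝ)))
    (htZ : convexHull ℝ (t : Set (Fin N → ℝ)) ⊆ I.Zact) :
    IsOpen (S.O s) ∧ convexHull ℝ (t : Set (Fin N → ℝ)) ⊆ S.O s ∧ ContDiffOn ℝ ∞ (S.Bt s t ht.1) (S.O s) ∧
      (∀ x ∈ convexHull ℝ (t : Set (Fin N → ℝ)), S.fbend x ∈ I.e.source ∧ I.e (S.fbend x) = S.Bt s t ht.1 x) ∧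
      ∀ x ∈ convexHull ℝ (t : Set (Fin N → ℝ)), ∀ u ∈ vectorSpan ℝ (t : Set (Fin N → ℝ)),
        fderiv ℝ (S.Bt s t ht.1) x u = 0 → u = 0 := by
  refine ⟨(S.hmodel s hs).1, (S.active_subset hs hts htZ).2, S.contDiffOn_Bt hs ht.1,
    fun x hx => ⟨(S.fbend_eq_on_active hs ht.1 hts htZ hx).1, (S.fbend_eq_on_active hs ht.1 hts htZ hx).2.1⟩,
    fun x hx u hu h0 => ?_⟩
  obtain ⟨B', hB', hinj⟩ := S.bt_injective hs ht hts htZ hx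
  rw [hB'.fderiv] at h0
  exact hinj u hu h0

/-- **Straightness** (WS2 contract (o5)): on a simplex of the refinement inside the zone of `R₂`,
`e ∘ f'` is the affine secant map, which is also `Λ`. [folklore] -/
theorem straight {t : Finset (Fin N → ℝ)} (ht : t ∈ S.P.faces)
    (ht2 : convexHull ℝ (t : Set (Fin N → ℝ)) ⊆ zone I.K I.f I.e I.R₂) {x : Fin N → ℝ}
    (hx : x ∈ convexHull ℝ (t : Set (Fin N → ℝ))) :
    S.fbend x ∈ I.e.source ∧ I.e (S.fbend x) = S.A t ht x ∧ S.Λ x = S.A t ht x := by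
  have hx2 := ht2 hx
  have hxD : x ∈ I.D := I.zone_subset_D I.R₂t hx2
  have hFx : I.F x ∈ I.R₂ := ((I.mem_zone_iff_F I.R₂t).1 hx2).2
  obtain ⟨hsrc, heq⟩ := S.fbend_mem_source hxD
  have hΛ : S.Λ x = S.A t ht x := S.Λ_eqOn ht hx
  refine ⟨hsrc, ?_, hΛ⟩
  rw [heq]
  simp [Bmap, I.hθ1 _ hFx, hΛ]

/-- Simplices of the refinement meeting the zone of `R₁` lie in the zone of `R₂`. [folklore] -/
theorem subset_zone₂_of_meets₁ {t : Finset (Fin N → ℝ)} (ht : t ∈ S.P.faces)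
    (hmeet : (convexHull ℝ (t : Set (Fin N → ℝ)) ∩ zone I.K I.f I.e I.R₁).Nonempty) :
    convexHull ℝ (t : Set (Fin N → ℝ)) ⊆ zone I.K I.f I.e I.R₂ := by
  have hη4 : S.η₀ ≤ I.η := by linarith [S.η₀_le, I.hη]
  have hsub : cthickening S.η₀ I.R₁ ⊆ I.R₂ := (cthickening_mono hη4 _).trans I.h12
  have h := I.subset_zone_of_small S.hτb'
    (fun x hx => (S.P.convexHull_subset_space ht hx |> fun h => by rwa [S.P_space] at h))
    (fun x hx y hy => S.dist_le_tau_of_mem_P ht hy hx) I.R₁_subset_R₄ (hsub.trans I.R₂t) hmeet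
  exact h.trans (zone_mono hsub)

/-! ### Part H: coverage near the protected set -/

/-- `Y` lies in the chart target. [folklore] -/
theorem _root_.Literature.Topology.FourManifolds.BendInput.Y_subset_target (I : BendInput n N M) :
    I.Y ⊆ I.e.target := by
  rintro _ ⟨x, hx, rfl⟩
  exact I.e.map_source hx.2

/-- The half-level `cthickening (η/2) R₃` lies in `R₄`. [folklore] -/
theorem _root_.Literature.Topology.FourManifolds.BendInput.half_subset_R₄ (I : BendInput n N M) :
    cthickening (I.η / 2) I.R₃ ⊆ I.R₄ :=
  (cthickening_mono (by linarith [I.hη]) _).trans I.h34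

/-- The image of the half-level zone: the compact part of `M` where bending may happen nearby.
[folklore] -/
def _root_.Literature.Topology.FourManifolds.BendInput.Mhalf (I : BendInput n N M) : Set M :=
  I.f '' zone I.K I.f I.e (cthickening (I.η / 2) I.R₃)

/-- Auxiliary step of the bending construction (`isCompact_Mhalf`). [folklore] -/
theorem _root_.Literature.Topology.FourManifolds.BendInput.isCompact_Mhalf (I : BendInput n N M) :
    IsCompact I.Mhalf := by
  have hZ : IsCompact (zone I.K I.f I.e (cthickening (I.η / 2) I.R₃)) :=
    isCompact_zone I.faces_finite I.cont I.hR₃.cthickening (I.half_subset_R₄.trans I.hR₄t)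
  exact hZ.image_of_continuousOn (I.continuousOn_f.mono zone_subset_space)

/-- **Far from the bending, top simplices are kept and unbent.** If a top simplex of the refinement
contains a point mapped outside `Mhalf`, then no point of it is in `D` with chart image in
`cthickening (η/4) R₃`; hence it is kept and `f' = f` on it. [folklore] -/
theorem kept_of_notMem_Mhalf {t : Finset (Fin N → ℝ)} (ht : t ∈ S.PTop) {x' : Fin N → ℝ}
    (hx' : x' ∈ convexHull ℝ (t : Set (Fin N → ℝ))) (hfar : I.f x' ∉ I.Mhalf) :
    t ∈ S.KeptTop ∧ EqOn S.fbend I.f (convexHull ℝ (t : Set (Fin N → ℝ))) := by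
  have hnot : ∀ x ∈ convexHull ℝ (t : Set (Fin N → ℝ)), x ∈ I.D → I.F x ∉ cthickening (I.η / 4) I.R₃ := by
    intro x hx hxD hF
    have h4t : cthickening (I.η / 4) I.R₃ ⊆ I.R₄ := (cthickening_mono (by linarith [I.hη]) _).trans I.h34
    have hxZ : x ∈ zone I.K I.f I.e (cthickening (I.η / 4) I.R₃) :=
      (I.mem_zone_iff_F (h4t.trans I.hR₄t)).2 ⟨hxD, hF⟩
    have hsub : cthickening S.η₀ (cthickening (I.η / 4) I.R₃) ⊆ cthickening (I.η / 2) I.R₃ :=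
      (cthickening_cthickening_subset S.η₀_nonneg (by linarith [I.hη]) _).trans
        (cthickening_mono (by linarith [S.η₀_le]) _)
    have h := I.subset_zone_of_small S.hτb'
      (fun y hy => (S.P.convexHull_subset_space ht.1 hy |> fun h => by rwa [S.P_space] at h))
      (fun a ha b hb => S.dist_le_tau_of_mem_P ht.1 hb ha) h4t
      (hsub.trans (I.half_subset_R₄.trans I.hR₄t)) ⟨x, hx, hxZ⟩
    exact hfar ⟨x', zone_mono hsub (h hx'), rfl⟩
  refine ⟨⟨ht, fun x hx hxD hF => (hnot x hx hxD hF).elim⟩, fun x hx => ?_⟩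
  by_cases hxD : x ∈ I.D
  · exact S.fbend_eq_f_of_notMem_R₃ fun h3 => hnot x hx hxD (self_subset_cthickening _ h3)
  · exact S.fbend_of_notMem hxD

/-- **Near a protected point of the bending region, top simplices are kept.** [folklore] -/
theorem kept_of_near_prot {p : M} (hp : p ∈ I.Prot) (hps : p ∈ I.e.source)
    (hp2 : I.e p ∈ cthickening (I.η / 2) I.R₃) {t : Finset (Fin N → ℝ)} (ht : t ∈ S.PTop)
    {x' : Fin N → ℝ} (hx' : x' ∈ convexHull ℝ (t : Set (Fin N → ℝ))) (hx'D : x' ∈ I.D)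
    (hdist : dist (I.F x') (I.e p) ≤ S.ρ₀) : t ∈ S.KeptTop := by
  have hball : closedBall (I.e p) S.ρP ⊆ I.Y := S.hρPb p hp hps (I.half_subset_R₄ hp2)
  refine ⟨ht, fun x hx hxD hF => ?_⟩
  -- `F x` is within `η₀ + ρ₀` of `e p`
  have h4t : cthickening (I.η / 4) I.R₃ ⊆ I.R₄ := (cthickening_mono (by linarith [I.hη]) _).trans I.h34
  have hxZ4 : x ∈ zone I.K I.f I.e I.R₄ := (I.mem_zone_iff_F I.hR₄t).2 ⟨hxD, h4t hF⟩
  have hx'K : x' ∈ I.K.space := hx'D.1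
  have hd1 : dist (I.F x') (I.F x) ≤ S.η₀ := (S.hτb' x hxZ4 x' hx'K (S.dist_le_tau_of_mem_P ht.1 hx' hx)).2
  intro z hz
  apply hball
  rw [mem_closedBall] at hz ⊢
  calc dist z (I.e p) ≤ dist z (I.F x) + dist (I.F x) (I.F x') + dist (I.F x') (I.e p) := dist_triangle4 _ _ _ _
    _ ≤ S.ρ₀ + S.η₀ + S.ρ₀ := by rw [dist_comm (I.F x)]; linarith
    _ ≤ S.ρP := by linarith [S.ρ₀_le_ρP, S.η₀_le_ρP, S.hρP]

/-- **Local surjectivity of `g` on good balls**: every point within `3ρ₀/8` of `g z₀` is `g z`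
for some `z` within `ρ₀/2` of `z₀`. [folklore] -/
theorem exists_g_eq {z₀ : 𝔼 n} (hz₀ : z₀ ∈ cthickening (I.η / 2) I.R₃)
    (hball : closedBall z₀ S.ρ₀ ⊆ I.Y) {z' : 𝔼 n} (hz' : dist z' (S.g z₀) ≤ 3 * S.ρ₀ / 8) :
    ∃ z ∈ closedBall z₀ (S.ρ₀ / 2), S.g z = z' := by
  rcases subsingleton_or_nontrivial (𝔼 n) with h | h
  · exact ⟨z₀, mem_closedBall_self (by linarith [S.ρ₀_pos]), Subsingleton.elim _ _⟩
  · have happ := S.approx_ball hz₀ hball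
    set L : 𝔼 n ≃L[ℝ] 𝔼 n := ContinuousLinearEquiv.refl ℝ (𝔼 n) with hL
    have hN : ((L.toNonlinearRightInverse).nnnorm : ℝ) = 1 := by
      show ((‖(L.symm : 𝔼 n →L[ℝ] 𝔼 n)‖₊ : ℝ≥0) : ℝ) = 1
      rw [hL, ContinuousLinearEquiv.refl_symm, ContinuousLinearEquiv.coe_refl, ContinuousLinearMap.nnnorm_id]
      rfl
    have hsurj := happ.surjOn_closedBall_of_nonlinearRightInverse L.toNonlinearRightInverse
      (ε := S.ρ₀ / 2) (b := z₀) (by linarith [S.ρ₀_pos])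
      (closedBall_subset_closedBall (by linarith [S.ρ₀_pos]))
    rw [hN] at hsurj
    have hmem : z' ∈ closedBall (S.g z₀) ((1⁻¹ - ((⟨S.ε', S.ε'_nonneg⟩ : ℝ≥0) : ℝ)) * (S.ρ₀ / 2)) := by
      rw [mem_closedBall]
      refine hz'.trans ?_
      have : ((⟨S.ε', S.ε'_nonneg⟩ : ℝ≥0) : ℝ) = S.ε' := rfl
      rw [this, inv_one]
      nlinarith [S.ε'_le, S.ρ₀_pos]
    obtain ⟨z, hz, hgz⟩ := hsurj hmem
    exact ⟨z, hz, hgz⟩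

/-- **Coverage near the protected set** (WS2 contract (o7)): every protected point has an open
neighbourhood inside `f' '' K''.space`. [folklore] -/
theorem exists_open_subset_image {p : M} (hp : p ∈ I.Prot) :
    ∃ U : Set M, IsOpen U ∧ p ∈ U ∧ U ⊆ S.fbend '' S.Kb.space := by
  by_cases hfar : p ∉ I.Mhalf
  · -- Case A: far from the bending
    refine ⟨interior (I.f '' I.K.space) \ I.Mhalf, isOpen_interior.sdiff I.isCompact_Mhalf.isClosed,
      ⟨I.hProtint hp, hfar⟩, fun q hq => ?_⟩
    obtain ⟨x', hx'K, rfl⟩ := interior_subset hq.1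
    obtain ⟨t, ht, hx't⟩ := S.exists_PTop_of_mem_space hx'K
    obtain ⟨hkept, hunbent⟩ := S.kept_of_notMem_Mhalf ht hx't hq.2
    exact ⟨x', (S.Kb).convexHull_subset_space (S.mem_Kb_of_keptTop hkept) hx't, hunbent hx't⟩
  · -- Case B: `p = f x₀` with `x₀` in the half-level zone
    push Not at hfar
    obtain ⟨x₀, hx₀, rfl⟩ := hfar
    have hx₀D : x₀ ∈ I.D := I.zone_subset_D (I.half_subset_R₄.trans I.hR₄t) hx₀
    have hps : I.f x₀ ∈ I.e.source := hx₀D.2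
    have hp2 : I.e (I.f x₀) ∈ cthickening (I.η / 2) I.R₃ :=
      ((I.mem_zone_iff_F (I.half_subset_R₄.trans I.hR₄t)).1 hx₀).2
    have hballY : closedBall (I.F x₀) S.ρ₀ ⊆ I.Y :=
      (closedBall_subset_closedBall (by linarith [S.ρ₀_le_ρP, S.hρP])).trans
        (S.hρPb _ hp hps (I.half_subset_R₄ hp2))
    -- the neighbourhood `e.symm '' ball (e p) (ρ₀ / 8)`
    have hballt : ball (I.F x₀) (S.ρ₀ / 8) ⊆ I.e.target :=
      (ball_subset_closedBall.trans (closedBall_subset_closedBall (by linarith [S.ρ₀_pos]))).trans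
        (hballY.trans I.Y_subset_target)
    refine ⟨I.e.symm '' ball (I.F x₀) (S.ρ₀ / 8), I.e.symm.isOpen_image_of_subset_source isOpen_ball
      (by rw [I.e.symm_source]; exact hballt), ⟨I.F x₀, mem_ball_self (by linarith [S.ρ₀_pos]),
      I.e.left_inv hps⟩, ?_⟩
    rintro _ ⟨z', hz', rfl⟩
    -- `z' = g z` for some `z ∈ closedBall (F x₀) (ρ₀/2) ⊆ Y`
    have hz'g : dist z' (S.g (I.F x₀)) ≤ 3 * S.ρ₀ / 8 := by
      have h1 := S.norm_g_sub_le (z := I.F x₀) ⟨x₀, hx₀D, rfl⟩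
      rw [← dist_eq_norm] at h1
      calc dist z' (S.g (I.F x₀)) ≤ dist z' (I.F x₀) + dist (I.F x₀) (S.g (I.F x₀)) := dist_triangle _ _ _
        _ ≤ S.ρ₀ / 8 + S.δ₀ := by rw [dist_comm (I.F x₀)]; linarith [mem_ball.1 hz']
        _ ≤ 3 * S.ρ₀ / 8 := by linarith [S.δ₀_le_ρ₀, S.ρ₀_pos]
    obtain ⟨z, hz, hgz⟩ := S.exists_g_eq hp2 hballY hz'g
    have hzY : z ∈ I.Y := hballY (closedBall_subset_closedBall (by linarith [S.ρ₀_pos]) hz)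
    obtain ⟨x, hxD, rfl⟩ := hzY
    -- `z' = g (F x) = e (f' x)` and `x` lies in a kept simplex
    obtain ⟨hsrc, heq⟩ := S.fbend_mem_source hxD
    have hq : I.e.symm z' = S.fbend x := by
      rw [← hgz, S.g_F hxD, ← heq, I.e.left_inv hsrc]
    obtain ⟨t, ht, hxt⟩ := S.exists_PTop_of_mem_space hxD.1
    have hkept : t ∈ S.KeptTop :=
      S.kept_of_near_prot hp hps hp2 ht hxt hxD ((mem_closedBall.1 hz).trans (by linarith [S.ρ₀_pos]))
    exact ⟨x, (S.Kb).convexHull_subset_space (S.mem_Kb_of_keptTop hkept) hxt, hq.symm⟩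

/-! ### Part G: the comparison map `Ψ = f' ∘ f⁻¹` is an open embedding near the kept part -/

/-- **Inverting a continuous injection on a compact set**: the inverse is continuous on the image
(Hausdorff target). [folklore] -/
theorem _root_.Literature.Topology.FourManifolds.continuousOn_invFunOn_of_isCompact {X Z : Type*}
    [TopologicalSpace X] [TopologicalSpace Z] [T2Space Z] [Nonempty X] {f : X → Z} {K : Set X}
    (hK : IsCompact K) (hf : ContinuousOn f K) (hinj : InjOn f K) :
    ContinuousOn (Function.invFunOn f K) (f '' K) := by
  rw [continuousOn_iff_isClosed]
  intro t ht
  refine ⟨f '' (t ∩ K), ((hK.inter_left ht).image_of_continuousOn (hf.mono inter_subset_right)).isClosed, ?_⟩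
  ext p
  constructor
  · rintro ⟨hpt, x, hx, rfl⟩
    refine ⟨⟨x, ⟨?_, hx⟩, rfl⟩, x, hx, rfl⟩
    have : Function.invFunOn f K (f x) = x := hinj.leftInvOn_invFunOn hx
    rw [mem_preimage, this] at hpt
    exact hpt
  · rintro ⟨⟨x, ⟨hxt, hxK⟩, rfl⟩, -⟩
    refine ⟨?_, x, hxK, rfl⟩
    have : Function.invFunOn f K (f x) = x := hinj.leftInvOn_invFunOn hxK
    rw [mem_preimage, this]
    exact hxt

/-- The inverse of `f` on `K.space`. [folklore] -/
def _root_.Literature.Topology.FourManifolds.BendInput.finvK (I : BendInput n N M) : M → (Fin N → ℝ) :=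
  Function.invFunOn I.f I.K.space

/-- Auxiliary step of the bending construction (`finvK_f`). [folklore] -/
theorem _root_.Literature.Topology.FourManifolds.BendInput.finvK_f (I : BendInput n N M) {x : Fin N → ℝ}
    (hx : x ∈ I.K.space) : I.finvK (I.f x) = x :=
  I.inj.leftInvOn_invFunOn hx

/-- `f⁻¹` is continuous on `f '' K.space`. [folklore] -/
theorem _root_.Literature.Topology.FourManifolds.BendInput.continuousOn_finvK (I : BendInput n N M) :
    ContinuousOn I.finvK (I.f '' I.K.space) :=
  continuousOn_invFunOn_of_isCompact I.isCompact_space I.continuousOn_f I.inj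

open Classical in
/-- **The comparison map** `Ψ = f' ∘ f⁻¹` on `f '' K.space`, the identity elsewhere. [folklore] -/
def Ψ : M → M := fun p => if p ∈ I.f '' I.K.space then S.fbend (I.finvK p) else p

/-- `Ψ ∘ f = f'` on `K.space`. [folklore] -/
theorem Ψ_f {x : Fin N → ℝ} (hx : x ∈ I.K.space) : S.Ψ (I.f x) = S.fbend x := by
  have h : I.f x ∈ I.f '' I.K.space := ⟨x, hx, rfl⟩
  simp only [Ψ, if_pos h, I.finvK_f hx]

/-- The domain of the comparison map: the interior of `f '' K''.space`. [folklore] -/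
def V : Set M := interior (I.f '' S.Kb.space)

/-- Auxiliary step of the bending construction (`isOpen_V`). [folklore] -/
theorem isOpen_V : IsOpen S.V := isOpen_interior

/-- Auxiliary step of the bending construction (`V_subset`). [folklore] -/
theorem V_subset : S.V ⊆ I.f '' S.Kb.space := interior_subset

/-- Points of `V` are `f x` with `x` in the trimmed complex. [folklore] -/
theorem exists_of_mem_V {p : M} (hp : p ∈ S.V) : ∃ x ∈ S.Kb.space, I.f x = p := S.V_subset hp

/-- `f'` is continuous on `K''.space`. [folklore] -/
theorem continuousOn_fbend_Kb : ContinuousOn S.fbend S.Kb.space :=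
  continuousOn_space_of_forall S.Kb_finite fun _ hr => S.continuousOn_fbend hr.1

/-- **`Ψ` is continuous on `V`.** [folklore] -/
theorem continuousOn_Ψ : ContinuousOn S.Ψ S.V := by
  have hsub : S.V ⊆ I.f '' I.K.space := S.V_subset.trans (image_mono S.Kb_space_subset)
  have heq : EqOn S.Ψ (S.fbend ∘ I.finvK) S.V := fun p hp => by
    have h : p ∈ I.f '' I.K.space := hsub hp
    simp only [Ψ, if_pos h, Function.comp_apply]
  refine ContinuousOn.congr ?_ heq
  refine S.continuousOn_fbend_Kb.comp (I.continuousOn_finvK.mono hsub) fun p hp => ?_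
  obtain ⟨x, hx, rfl⟩ := S.exists_of_mem_V hp
  rw [I.finvK_f (S.Kb_space_subset hx)]
  exact hx

/-- **`Ψ` is injective on `V`.** [folklore] -/
theorem injOn_Ψ : InjOn S.Ψ S.V := by
  intro p hp q hq hpq
  obtain ⟨x, hx, rfl⟩ := S.exists_of_mem_V hp
  obtain ⟨y, hy, rfl⟩ := S.exists_of_mem_V hq
  rw [S.Ψ_f (S.Kb_space_subset hx), S.Ψ_f (S.Kb_space_subset hy)] at hpq
  rw [S.injOn_fbend hx hy hpq]

/-- The quarter-level bending region `Mq = f '' zone (cthickening (η/4) R₃)`. [folklore] -/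
def _root_.Literature.Topology.FourManifolds.BendInput.Mq (I : BendInput n N M) : Set M :=
  I.f '' zone I.K I.f I.e (cthickening (I.η / 4) I.R₃)

/-- Auxiliary step of the bending construction (`quarter_subset_R₄`). [folklore] -/
theorem _root_.Literature.Topology.FourManifolds.BendInput.quarter_subset_R₄ (I : BendInput n N M) :
    cthickening (I.η / 4) I.R₃ ⊆ I.R₄ :=
  (cthickening_mono (by linarith [I.hη]) _).trans I.h34

/-- Auxiliary step of the bending construction (`isCompact_Mq`). [folklore] -/
theorem _root_.Literature.Topology.FourManifolds.BendInput.isCompact_Mq (I : BendInput n N M) :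
    IsCompact I.Mq := by
  have hZ : IsCompact (zone I.K I.f I.e (cthickening (I.η / 4) I.R₃)) :=
    isCompact_zone I.faces_finite I.cont I.hR₃.cthickening (I.quarter_subset_R₄.trans I.hR₄t)
  exact hZ.image_of_continuousOn (I.continuousOn_f.mono zone_subset_space)

/-- **Off `Mq` the comparison map is the identity** (for points of `f '' K.space`, and trivially
elsewhere). [folklore] -/
theorem Ψ_eq_self {p : M} (hp : p ∉ I.Mq) : S.Ψ p = p := by
  by_cases hpK : p ∈ I.f '' I.K.space
  · obtain ⟨x, hx, rfl⟩ := hpK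
    rw [S.Ψ_f hx]
    by_cases hxD : x ∈ I.D
    · refine S.fbend_eq_f_of_notMem_R₃ fun h3 => hp ⟨x, ?_, rfl⟩
      exact (I.mem_zone_iff_F (I.quarter_subset_R₄.trans I.hR₄t)).2 ⟨hxD, self_subset_cthickening _ h3⟩
    · exact S.fbend_of_notMem hxD
  · simp [Ψ, hpK]

/-- Near a point of `V ∩ Mq`: the good ball about its chart image. [folklore] -/
theorem good_ball_of_mem_V {x₀ : Fin N → ℝ} (hx₀ : x₀ ∈ S.Kb.space)
    (hz : x₀ ∈ zone I.K I.f I.e (cthickening (I.η / 4) I.R₃)) :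
    x₀ ∈ I.D ∧ I.F x₀ ∈ cthickening (I.η / 4) I.R₃ ∧ closedBall (I.F x₀) S.ρ₀ ⊆ I.Y := by
  obtain ⟨hD, hF⟩ := (I.mem_zone_iff_F (I.quarter_subset_R₄.trans I.hR₄t)).1 hz
  exact ⟨hD, hF, S.good_of_mem_Kb_space hx₀ hD hF⟩

/-- The local model of `g` on a good ball, as an open partial homeomorphism of the chart space
(inverse function estimates). [folklore] -/
def γ {z₀ : 𝔼 n} (hz₀ : z₀ ∈ cthickening (I.η / 2) I.R₃) (hball : closedBall z₀ S.ρ₀ ⊆ I.Y) :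
    OpenPartialHomeomorph (𝔼 n) (𝔼 n) :=
  ((S.approx_ball hz₀ hball).mono_set ball_subset_closedBall).toOpenPartialHomeomorph S.g
    (ball z₀ S.ρ₀) S.hc_refl isOpen_ball

/-- Auxiliary step of the bending construction (`γ_coe`). [folklore] -/
theorem γ_coe {z₀ : 𝔼 n} (hz₀ : z₀ ∈ cthickening (I.η / 2) I.R₃) (hball : closedBall z₀ S.ρ₀ ⊆ I.Y) :
    (S.γ hz₀ hball : 𝔼 n → 𝔼 n) = S.g := rfl

/-- Auxiliary step of the bending construction (`γ_source`). [folklore] -/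
theorem γ_source {z₀ : 𝔼 n} (hz₀ : z₀ ∈ cthickening (I.η / 2) I.R₃) (hball : closedBall z₀ S.ρ₀ ⊆ I.Y) :
    (S.γ hz₀ hball).source = ball z₀ S.ρ₀ := rfl

/-- `g` maps `Y` into the chart target. [folklore] -/
theorem g_mem_target {z : 𝔼 n} (hz : z ∈ I.Y) : S.g z ∈ I.e.target := by
  obtain ⟨x, hx, rfl⟩ := hz
  rw [S.g_F hx]
  exact (S.Bmap_mem hx).1

/-- **Local chart description of `Ψ`**: on `e.symm '' ball (F x₀) ρ₀ ∩ V` we have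
`Ψ = e.symm ∘ g ∘ e`. [folklore] -/
theorem Ψ_local {x₀ : Fin N → ℝ} (hball : closedBall (I.F x₀) S.ρ₀ ⊆ I.Y) {q : M} (hqV : q ∈ S.V)
    (hq : q ∈ I.e.symm '' ball (I.F x₀) S.ρ₀) :
    q ∈ I.e.source ∧ I.e q ∈ ball (I.F x₀) S.ρ₀ ∧ S.Ψ q = I.e.symm (S.g (I.e q)) := by
  obtain ⟨z, hz, rfl⟩ := hq
  have hzt : z ∈ I.e.target := I.Y_subset_target (hball (ball_subset_closedBall hz))
  have hsrc : I.e.symm z ∈ I.e.source := I.e.map_target hzt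
  have hez : I.e (I.e.symm z) = z := I.e.right_inv hzt
  refine ⟨hsrc, by rwa [hez], ?_⟩
  obtain ⟨x, hx, hfx⟩ := S.exists_of_mem_V hqV
  have hxD : x ∈ I.D := ⟨S.Kb_space_subset hx, show I.f x ∈ I.e.source by rw [hfx]; exact hsrc⟩
  have hF : I.F x = z := by show I.e (I.f x) = z; rw [hfx, hez]
  rw [← hfx, S.Ψ_f (S.Kb_space_subset hx), S.fbend_of_mem hxD, ← S.g_F hxD, hF, hfx, hez]

/-- The local open piece of `V` about a point of `V ∩ Mq`. [folklore] -/
def Opiece (x₀ : Fin N → ℝ) : Set M := S.V ∩ I.e.symm '' ball (I.F x₀) S.ρ₀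

/-- Auxiliary step of the bending construction (`isOpen_Opiece`). [folklore] -/
theorem isOpen_Opiece {x₀ : Fin N → ℝ} (hball : closedBall (I.F x₀) S.ρ₀ ⊆ I.Y) : IsOpen (S.Opiece x₀) := by
  refine S.isOpen_V.inter (I.e.symm.isOpen_image_of_subset_source isOpen_ball ?_)
  rw [I.e.symm_source]
  exact ball_subset_closedBall.trans (hball.trans I.Y_subset_target)

/-- **The image of a local piece under `Ψ` is open.** [folklore] -/
theorem isOpen_image_Opiece {x₀ : Fin N → ℝ} (hz₀ : I.F x₀ ∈ cthickening (I.η / 2) I.R₃)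
    (hball : closedBall (I.F x₀) S.ρ₀ ⊆ I.Y) : IsOpen (S.Ψ '' S.Opiece x₀) := by
  -- `Ψ '' O = e.symm '' (γ '' (e '' (O ∩ source)))`
  set O := S.Opiece x₀ with hO
  have hOsrc : O ⊆ I.e.source := fun q hq => (S.Ψ_local hball hq.1 hq.2).1
  have h1 : IsOpen (I.e '' O) := I.e.isOpen_image_of_subset_source (S.isOpen_Opiece hball) hOsrc
  have h2 : I.e '' O ⊆ (S.γ hz₀ hball).source := by
    rintro _ ⟨q, hq, rfl⟩
    rw [S.γ_source]
    exact (S.Ψ_local hball hq.1 hq.2).2.1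
  have h3 : IsOpen (S.γ hz₀ hball '' (I.e '' O)) := (S.γ hz₀ hball).isOpen_image_of_subset_source h1 h2
  have h4 : S.γ hz₀ hball '' (I.e '' O) ⊆ I.e.target := by
    rintro _ ⟨z, ⟨q, hq, rfl⟩, rfl⟩
    rw [S.γ_coe]
    exact S.g_mem_target (hball (ball_subset_closedBall (S.Ψ_local hball hq.1 hq.2).2.1))
  have h5 : IsOpen (I.e.symm '' (S.γ hz₀ hball '' (I.e '' O))) :=
    I.e.symm.isOpen_image_of_subset_source h3 (by rw [I.e.symm_source]; exact h4)
  have heq : S.Ψ '' O = I.e.symm '' (S.γ hz₀ hball '' (I.e '' O)) := by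
    ext p
    simp only [mem_image]
    constructor
    · rintro ⟨q, hq, rfl⟩
      exact ⟨S.g (I.e q), ⟨I.e q, ⟨q, hq, rfl⟩, rfl⟩, (S.Ψ_local hball hq.1 hq.2).2.2.symm⟩
    · rintro ⟨_, ⟨_, ⟨q, hq, rfl⟩, rfl⟩, rfl⟩
      exact ⟨q, hq, (S.Ψ_local hball hq.1 hq.2).2.2⟩
  rw [heq]
  exact h5

/-- **`Ψ '' V` is open.** [folklore] -/
theorem isOpen_image_V : IsOpen (S.Ψ '' S.V) := by
  rw [isOpen_iff_forall_mem_open]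
  rintro _ ⟨p, hpV, rfl⟩
  by_cases hpq : p ∈ I.Mq
  · obtain ⟨x₀, hx₀z, rfl⟩ := hpq
    obtain ⟨x, hx, hfx⟩ := S.exists_of_mem_V hpV
    have hxx : x = x₀ := I.inj (S.Kb_space_subset hx) (zone_subset_space hx₀z) hfx
    subst hxx
    obtain ⟨hD, hF, hball⟩ := S.good_ball_of_mem_V hx hx₀z
    have hz₀ : I.F x ∈ cthickening (I.η / 2) I.R₃ := cthickening_mono (by linarith [I.hη]) _ hF
    refine ⟨S.Ψ '' S.Opiece x, image_mono inter_subset_left, S.isOpen_image_Opiece hz₀ hball,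
      ⟨I.f x, ⟨hpV, I.F x, mem_ball_self S.ρ₀_pos, I.e.left_inv hD.2⟩, rfl⟩⟩
  · -- `Ψ = id` on the open set `V \ Mq`
    refine ⟨S.V \ I.Mq, fun q hq => ⟨q, hq.1, S.Ψ_eq_self hq.2⟩, S.isOpen_V.sdiff I.isCompact_Mq.isClosed, ?_⟩
    rw [S.Ψ_eq_self hpq]
    exact ⟨hpV, hpq⟩

open Classical in
/-- The inverse of the comparison map on `Ψ '' V` (the identity elsewhere). [folklore] -/
def Ψinv : M → M := fun q => if h : ∃ p ∈ S.V, S.Ψ p = q then h.choose else q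

/-- Auxiliary step of the bending construction (`Ψinv_Ψ`). [folklore] -/
theorem Ψinv_Ψ {p : M} (hp : p ∈ S.V) : S.Ψinv (S.Ψ p) = p := by
  have h : ∃ p' ∈ S.V, S.Ψ p' = S.Ψ p := ⟨p, hp, rfl⟩
  simp only [Ψinv, dif_pos h]
  exact S.injOn_Ψ h.choose_spec.1 hp h.choose_spec.2

/-- Auxiliary step of the bending construction (`Ψ_Ψinv`). [folklore] -/
theorem Ψ_Ψinv {q : M} (hq : q ∈ S.Ψ '' S.V) : S.Ψ (S.Ψinv q) = q ∧ S.Ψinv q ∈ S.V := by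
  obtain ⟨p, hp, rfl⟩ := hq
  rw [S.Ψinv_Ψ hp]
  exact ⟨rfl, hp⟩

/-- **`Ψinv` is continuous on `Ψ '' V`.** [folklore] -/
theorem continuousOn_Ψinv : ContinuousOn S.Ψinv (S.Ψ '' S.V) := by
  intro q hq
  obtain ⟨p, hpV, rfl⟩ := hq
  -- it suffices to find an open neighbourhood of `Ψ p` on which `Ψinv` agrees with a continuous map
  suffices h : ∃ W : Set M, IsOpen W ∧ S.Ψ p ∈ W ∧ W ⊆ S.Ψ '' S.V ∧ ContinuousOn S.Ψinv W by
    obtain ⟨W, hWo, hpW, -, hWc⟩ := h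
    exact (hWc.continuousAt (hWo.mem_nhds hpW)).continuousWithinAt
  by_cases hpq : p ∈ I.Mq
  · obtain ⟨x₀, hx₀z, rfl⟩ := hpq
    obtain ⟨x, hx, hfx⟩ := S.exists_of_mem_V hpV
    have hxx : x = x₀ := I.inj (S.Kb_space_subset hx) (zone_subset_space hx₀z) hfx
    subst hxx
    obtain ⟨hD, hF, hball⟩ := S.good_ball_of_mem_V hx hx₀z
    have hz₀ : I.F x ∈ cthickening (I.η / 2) I.R₃ := cthickening_mono (by linarith [I.hη]) _ hF
    set O := S.Opiece x with hO
    have hpO : I.f x ∈ O := ⟨hpV, I.F x, mem_ball_self S.ρ₀_pos, I.e.left_inv hD.2⟩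
    refine ⟨S.Ψ '' O, S.isOpen_image_Opiece hz₀ hball, ⟨I.f x, hpO, rfl⟩, image_mono inter_subset_left, ?_⟩
    -- on `Ψ '' O`, `Ψinv = e.symm ∘ γ.symm ∘ e`
    set γ := S.γ hz₀ hball with hγ
    have heq : EqOn S.Ψinv (fun q => I.e.symm (γ.symm (I.e q))) (S.Ψ '' O) := by
      rintro _ ⟨q, hq, rfl⟩
      obtain ⟨hsrc, hball', hΨ⟩ := S.Ψ_local hball hq.1 hq.2
      rw [S.Ψinv_Ψ hq.1, hΨ]
      have hgt : S.g (I.e q) ∈ I.e.target := S.g_mem_target (hball (ball_subset_closedBall hball'))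
      beta_reduce
      rw [I.e.right_inv hgt]
      have : γ.symm (S.g (I.e q)) = I.e q := by
        have h := γ.left_inv (show I.e q ∈ γ.source by rw [hγ, S.γ_source]; exact hball')
        rw [hγ, S.γ_coe] at h
        rw [hγ]
        exact h
      rw [this, I.e.left_inv hsrc]
    refine ContinuousOn.congr ?_ heq
    -- continuity of the composite
    have hmaps1 : MapsTo I.e (S.Ψ '' O) γ.target := by
      rintro _ ⟨q, hq, rfl⟩
      obtain ⟨hsrc, hball', hΨ⟩ := S.Ψ_local hball hq.1 hq.2
      rw [hΨ, I.e.right_inv (S.g_mem_target (hball (ball_subset_closedBall hball')))]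
      have : S.g (I.e q) = γ (I.e q) := by rw [hγ, S.γ_coe]
      rw [this]
      exact γ.map_source (by rw [hγ, S.γ_source]; exact hball')
    have hsrc2 : S.Ψ '' O ⊆ I.e.source := by
      rintro _ ⟨q, hq, rfl⟩
      obtain ⟨hsrc, hball', hΨ⟩ := S.Ψ_local hball hq.1 hq.2
      rw [hΨ]
      exact I.e.map_target (S.g_mem_target (hball (ball_subset_closedBall hball')))
    have hmaps2 : MapsTo (fun q => γ.symm (I.e q)) (S.Ψ '' O) I.e.target := by
      rintro _ ⟨q, hq, rfl⟩
      obtain ⟨hsrc, hball', hΨ⟩ := S.Ψ_local hball hq.1 hq.2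
      show γ.symm (I.e (S.Ψ q)) ∈ I.e.target
      rw [hΨ, I.e.right_inv (S.g_mem_target (hball (ball_subset_closedBall hball')))]
      have h := γ.left_inv (show I.e q ∈ γ.source by rw [hγ, S.γ_source]; exact hball')
      rw [hγ, S.γ_coe] at h
      rw [show (S.γ hz₀ hball).symm (S.g (I.e q)) = I.e q from h]
      exact I.Y_subset_target (hball (ball_subset_closedBall hball'))
    exact I.e.continuousOn_symm.comp ((γ.continuousOn_symm.comp (I.e.continuousOn.mono hsrc2) hmaps1)) hmaps2
  · refine ⟨S.V \ I.Mq, S.isOpen_V.sdiff I.isCompact_Mq.isClosed, ?_, fun q hq => ⟨q, hq.1, S.Ψ_eq_self hq.2⟩, ?_⟩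
    · rw [S.Ψ_eq_self hpq]; exact ⟨hpV, hpq⟩
    · have heq : EqOn S.Ψinv id (S.V \ I.Mq) := fun q hq => by
        have h := S.Ψinv_Ψ hq.1
        rwa [S.Ψ_eq_self hq.2] at h
      exact continuousOn_id.congr heq

/-- **Displacement of `Ψ` in the chart**: for `q ∈ V` in the chart source, `Ψ q` is in the chart
source and `‖e (Ψ q) - e q‖ ≤ δ₀ ≤ εreq`. [folklore] -/
theorem norm_e_Ψ_sub_le {q : M} (hqV : q ∈ S.V) (hqs : q ∈ I.e.source) :
    S.Ψ q ∈ I.e.source ∧ ‖I.e (S.Ψ q) - I.e q‖ ≤ S.δ₀ := by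
  obtain ⟨x, hx, rfl⟩ := S.exists_of_mem_V hqV
  have hxD : x ∈ I.D := ⟨S.Kb_space_subset hx, hqs⟩
  rw [S.Ψ_f (S.Kb_space_subset hx)]
  exact ⟨(S.fbend_mem_source hxD).1, S.norm_e_fbend_sub_le hxD⟩

/-- **Protected points lie in `V`.** [folklore] -/
theorem prot_subset_V : I.Prot ⊆ S.V := by
  intro p hp
  rw [V, mem_interior]
  by_cases hfar : p ∉ I.Mhalf
  · refine ⟨interior (I.f '' I.K.space) \ I.Mhalf, fun q hq => ?_,
      isOpen_interior.sdiff I.isCompact_Mhalf.isClosed, ⟨I.hProtint hp, hfar⟩⟩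
    obtain ⟨x', hx'K, rfl⟩ := interior_subset hq.1
    obtain ⟨t, ht, hx't⟩ := S.exists_PTop_of_mem_space hx'K
    obtain ⟨hkept, -⟩ := S.kept_of_notMem_Mhalf ht hx't hq.2
    exact ⟨x', (S.Kb).convexHull_subset_space (S.mem_Kb_of_keptTop hkept) hx't, rfl⟩
  · push Not at hfar
    obtain ⟨x₀, hx₀, rfl⟩ := hfar
    have hx₀D : x₀ ∈ I.D := I.zone_subset_D (I.half_subset_R₄.trans I.hR₄t) hx₀
    have hps : I.f x₀ ∈ I.e.source := hx₀D.2
    have hp2 : I.e (I.f x₀) ∈ cthickening (I.η / 2) I.R₃ :=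
      ((I.mem_zone_iff_F (I.half_subset_R₄.trans I.hR₄t)).1 hx₀).2
    have hballY : closedBall (I.F x₀) S.ρ₀ ⊆ I.Y :=
      (closedBall_subset_closedBall (by linarith [S.ρ₀_le_ρP, S.hρP])).trans
        (S.hρPb _ hp hps (I.half_subset_R₄ hp2))
    have hballt : ball (I.F x₀) S.ρ₀ ⊆ I.e.target :=
      ball_subset_closedBall.trans (hballY.trans I.Y_subset_target)
    refine ⟨I.e.symm '' ball (I.F x₀) S.ρ₀, ?_, I.e.symm.isOpen_image_of_subset_source isOpen_ball
      (by rw [I.e.symm_source]; exact hballt), ⟨I.F x₀, mem_ball_self S.ρ₀_pos, I.e.left_inv hps⟩⟩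
    rintro _ ⟨z, hz, rfl⟩
    obtain ⟨x, hxD, rfl⟩ := hballY (ball_subset_closedBall hz)
    obtain ⟨t, ht, hxt⟩ := S.exists_PTop_of_mem_space hxD.1
    have hkept : t ∈ S.KeptTop := S.kept_of_near_prot hp hps hp2 ht hxt hxD (mem_ball.1 hz).le
    refine ⟨x, (S.Kb).convexHull_subset_space (S.mem_Kb_of_keptTop hkept) hxt, ?_⟩
    exact (I.e.left_inv hxD.2).symm ▸ rfl

end BendSetup

end BendInput

end Literature.Topology.FourManifolds
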